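import Summits.AnomalousDissipation.AnomalousDissipation.Theses.TaylorCertificates
import Literature.Analysis.FluidPDE.SteadyNavierStokesProofs
import Literature.Analysis.FluidPDE.SteadyNavierStokesRegularity
import Literature.Analysis.FluidPDE.EnergySpaceTorusProofs
import Literature.Analysis.FunctionSpaces.TorusFluidGlueProofs
import Literature.Analysis.FunctionSpaces.TorusLerayHelmholtzProofs
import Literature.Analysis.FunctionSpaces.TorusEnstrophyOrthogonality
import Literature.Analysis.FluidPDE.TwoHalfNavierStokes
import Literature.Analysis.FluidPDE.DoeringFoiasPowerProofs
import Literature.Analysis.FunctionSpaces.TorusPoincareMorrey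
import Literature.Analysis.FunctionSpaces.TorusSobolevSpaceProofs

/-!
# Disproof of `SteadyStatesLoudBounded` — findings of the standing adversary (crux stmt-AnomalousDissipation-13038)

Crux (route `TaylorCertificates`, rank 3): `∃ f : T³ → ℝ³` admissible (smooth, divergence free, mean
zero) `∃ ε₀ E ν₀ > 0, ∀ ν ∈ (0, ν₀)`, every smooth admissible steady state `u` of `NS_ν(f)` (weak
form against smooth divergence-free mean-zero tests) has `ν‖∇u‖² ≥ ε₀` (FLOOR) and `‖u‖² ≤ E`
(CEILING).

VERDICT SO FAR: NOT refuted — the crux resists (open-problem strength; see "Why it resists").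
Everything below is `sorry`-free with axioms `propext`, `Classical.choice`, `Quot.sound`; prose
lives in docstrings only.

## Index of findings
* §0 `crux_iff` — the decl is literally `∃ f, (admissible clauses) ∧ Body f` (`Iff.rfl`);
  `not_crux_iff`, `not_body_iff` (§8) spell out the exact shape of a refutation: for EVERY
  admissible `f`, a quiet-or-fat smooth steady branch as `ν → 0`.
* §1 bridge — `isSteady_iff_isSteadyWeakSolution` (the item's weak form = the tree's
  `Torus.IsSteadyWeakSolution` at the `H`-lift) and `exists_isSteady` (`#d ≤ 3`: Temam existence
  + regularity + smooth Helmholtz): the `∀ u` is never vacuous, on `T²` and on `T³`.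
* §2–§3 — reflection `isSteady_neg_neg`; `energy_identity` `ν‖∇u‖² = (f,u)`; `poincare`
  `4π²‖u‖² ≤ ‖∇u‖²`; `dissipation_le` `ν‖∇u‖² ≤ ‖f‖²/(4π²ν)` at every steady state.
* §4 LOAD-BEARING HYPOTHESES (each a theorem):
  - `cruxWithoutNuPos_false` — drop `0 < ν`: false for every `f` (reflect a steady state of
    `NS₁(f)` to viscosity `-1`);
  - `cruxWithoutNuLt_false` — drop `ν < ν₀`: false for every `f` (at large `ν` every steady
    state is quiet);
  - `cruxWithoutEpsPos_true` — drop `0 < ε₀`: trivially true (`f = 0`): the CEILING alone is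
    free, all content is in the FLOOR; `cruxWithoutNu0Pos_true` — drop `0 < ν₀`: vacuous;
  - `not_body_zero`, `force_ne_zero_of_body` — any witness `f` is nonzero.
* §5 DIMENSION — `not_body_fin_two`: the `T²` twin of the crux body is FALSE FOR EVERY SMOOTH
  `F` (steady enstrophy balance `ν‖ΔV‖² = -(ΔF,V)` by testing with `w = ΔV` and the 2-D
  orthogonality `∫⟪ΔV,(V·∇)V⟫ = 0`, plus `‖∇V‖² = -(V,ΔV)`: under the CEILING
  `ν‖∇V‖² ≤ (νT/2)E + (‖ΔF‖² + E)/(4T) → 0`); `not_cruxFinTwo`.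
* §6 PLANAR FORCES EXCLUDED — `not_body_twoHalf_planar`: for every smooth mean-zero
  `F : T² → ℝ²` the `x₃`-invariant horizontal force `(F,0)∘π` is NOT a witness on `T³` (planar
  steady states lift: `exists_pressure`, `isSteady_twoHalf_planar`, `body_of_body_twoHalf`).
  This is the steady-state form of the Alexakis–Doering barrier, proved for ALL planar `F` with no
  time averages.
* §7 UNIDIRECTIONAL FORCES EXCLUDED — `not_body_unidirectional`: for every smooth mean-zero
  `S ≢ 0` on `T²` the vertical force `(0,0,-ΔS)∘π` carries the exact laminar branch
  `(0,0,S/ν)∘π` (`isSteady_unidirectional`) of energy `‖S‖²/ν²` (`energy_unidirectional`): the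
  CEILING fails.  A family strictly larger than the Stokes-eigenmode (Kolmogorov / Marchioro
  barrier) forces — no eigenfunction condition on `S`.  Concrete instance `not_body_cosX`.
* §8 STRENGTHENINGS — `not_forall_admissible_body`: "every nonzero admissible `f` works" is
  FALSE (witness `(0,0,-Δcos 2πx₁)`); `eq_zero_of_laplacian_eq_zero` (mean-zero harmonic ⇒ 0);
  `not_body_iff`, `not_crux_iff`.
* §9 EULER PREIMAGES EXCLUDED, ENERGY SHELL — `not_body_neg_laplacian_of_euler`: for EVERY smooth
  admissible steady Euler flow `U ≢ 0` (`(U·∇)U = ∇q`) the force `-ΔU` carries the exact fat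
  branch `U/ν` (`isSteady_laminar_of_euler`; energy `‖U‖²/ν²`): one statement covering
  Kolmogorov/shear, Beltrami/ABC and the unidirectional family of §7 (Marchioro's barrier is the
  gravest-shell case).  `energy_floor_of_floor`: the FLOOR alone puts every steady state in the
  shell `‖u‖² ≥ ε₀²/‖f‖²`, so `Body f` pins all small-`ν` steady states of `f` into
  `ε₀²/‖f‖² ≤ ‖u‖² ≤ E`.
* §10 SCALING COVARIANCE — `isSteady_smul_iff`, `body_smul_iff`: `Body f ↔ Body (a²f)` (`a > 0`;
  steady states of `NS_ν(a²f)` are `a ×` those of `NS_{ν/a}(f)`): the witness set is a cone,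
  only the shape of `f` matters (large-Grashof limit at fixed shape).
* §11 NO JUNK — `isSteady_iff_exists_pressure` (classical equation with smooth pressure),
  `isSteady_iff_forall_divFree_tests` (mean-zero restriction on tests is harmless),
  `body_iff_bodyWeak` (`#d ≤ 3`: the body over SMOOTH steady states = the body over all steady
  weak solutions `U ∈ V` with spectral enstrophy and `H`-norm; Temam regularity) — neither the
  test class nor `IsSmooth u` is load-bearing.
* §12 STEADY STATES ARE NEVER SMALL — `norm_sq_force_le`, `energy_lower_all_steady`: testing
  with `w = f` gives `‖f‖² ≤ (sup‖Df‖ + ν/2)‖u‖² + (ν/2)‖Δf‖²` for EVERY steady state, no floor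
  assumed: a ν-uniform energy floor `‖u‖² ≥ ‖f‖²/(2 sup‖Df‖ + ν)` once `ν‖Δf‖² ≤ ‖f‖²`.  Quiet
  branches (if any) carry `O(1)` energy on which the work `(f,u)` degenerates; the CEILING of a
  witness must exceed `‖f‖²/(2 sup‖Df‖)`.

## Why the crux resists (briefing for provers / planners)
* `¬ crux ↔ ∀ admissible f on T³, ¬ Body f` (`not_crux_iff`).  Every kill above is
  `f`-SPECIFIC: it constrains the prover's `f` (genuinely three-dimensional: not `x₃`-invariant
  horizontal (§6), not unidirectional (§7), not `-Δ` of any steady Euler flow (§9: shear,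
  Beltrami/ABC, …)), and the `∃ f` absorbs all of them.
* No general mechanism is known in either direction.  QUIET branches need a smooth steady Euler
  state `v` with `P((v·∇)v) = f` AND its viscous continuation (`ν‖∇u_ν‖² = (f,u_ν) → (f,v) = 0`;
  Prandtl–Batchelor-type selection, unknown in 3-D).  FAT branches need `u = ν⁻¹U₀ + U₁ + …` with
  `U₀` a steady Euler flow whose linearisation is solvable against `f` (symmetric `f` only).
* First open sub-question (not covered here): mixed `x₃`-invariant forces `(F,R)∘π` with `R ≢ 0`,
  `F ≢ 0`; their `2½`-D steady states `(V,S)∘π` need the steady advection–diffusion equation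
  `νΔS − V·∇S + R = 0` (not in the tree), and `(R,S)` is not controlled by an enstrophy argument
  (passive scalars may dissipate anomalously), so even the `x₃`-invariant class is not closed.
* Symmetries tried: NS scaling maps the steady states of `NS_ν(a²f)` onto `a ×` those of
  `NS_{ν/a}(f)` — a covariance (§10: only the shape of `f` matters), not a kill; Galilean drifts
  are excluded (mean-zero `u`, and constants are steady only if `f = 0`); `(u,ν) ↦ (-u,-ν)` is
  spent in §4.  Junk/vacuity: none (`u` smooth, `exists_isSteady`, §11).
* NUMERICS (compute job `j006377`, evidence `compute-j006377.json` on the item; pseudo-spectral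
  Newton–GMRES continuation in `ν` of the PRIMARY steady branch from `ν = 1`, box `[0,2π)³`, 2/3
  dealiasing; the pool capped the run at 0.5 h so only `ν ≥ 0.046` was reached; Kolmogorov control
  reproduces the exact laminar branch `E = 1/(2ν²)`, `D = 1/(2ν)` to 1e-16; `N = 32` and `N = 48`
  agree to 4 digits).  For the Galloway–Proctor / cyclic force `f_GP = (sin z, sin x, sin y)` — the
  force pinned by this crux's lines — along the primary branch (`E = ⟨|u|²⟩`, `D = ν⟨|∇u|²⟩`):
    `ν    1.000 0.800 0.605 0.427 0.276 0.166 0.099 0.060 0.046`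
    `E    1.18  1.53  1.98  2.50  3.14  3.88  4.32  4.58  4.82`
    `D    1.27  1.41  1.50  1.53  1.49  1.39  1.25  1.08  1.01`
    `⟨|∇u|²⟩ 1.3 1.8  2.5   3.6   5.4   8.4  12.6  18.1  21.9`
  i.e. the energy saturates (local exponent `E ~ ν^-0.1…-0.2`) while the dissipation PEAKS at
  `ν ≈ 0.43` and then DECLINES with a growing decay exponent (local `D ~ ν^+0.07, +0.14, +0.20,
  +0.28, +0.26`; `⟨|∇u|²⟩ ~ ν^-0.73`, slower than the `ν⁻¹` a FLOOR needs).  At face value the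
  primary `f_GP` branch is heading QUIET (bounded energy, vanishing work `(f,u)`), which would sink
  the FLOOR at `f_GP`; but `Re ≈ 50–70` is pre-asymptotic and the trend is not a proof — follow-up
  jobs `j014392`/`j014397` (Newton + pseudo-transient continuation, `N = 32→48→64`, target
  `ν ≈ 0.01`) are queued and self-attach to the item.  Taylor–Green (`D` still rising at `ν = 0.06`,
  `|f|² = 0.25`) and the two-shell force (`D ≈ 1.85` flat for `ν ∈ [0.1, 0.43]`, `E ~ ν^-0.8`
  growing) are inconclusive at the reached `ν`.
-/

set_option linter.dupNamespace false

noncomputable section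

open MeasureTheory
open scoped InnerProductSpace RealInnerProductSpace ENNReal

namespace Summit.AnomalousDissipation.AnomalousDissipation.Cruxes.SteadyStatesLoudBounded.Disproof

open Literature.Analysis.FunctionSpaces Literature.Analysis.FunctionSpaces.Torus
open Literature.Analysis.FluidPDE Literature.Analysis.FluidPDE.Torus
open Summit.AnomalousDissipation.AnomalousDissipation.Theses.TaylorCertificates

/-- Local notation for the real Hilbert space `L²(T^d; ℝ^d)`. -/
local notation "L2T " d':max => Lp (EuclideanSpace ℝ d') 2 (volume : Measure (UnitAddTorus d'))

variable {d : Type} [Fintype d] [DecidableEq d]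

/-! ## §0 The crux, restated through named predicates -/

/-- The item's steady weak form: `∫ ⟪νΔu − (u·∇)u + f, w⟫ = 0` for every smooth divergence-free
mean-zero test field `w` (pressure-free form; the residual has zero mean, so mean-zero tests lose
nothing). [folklore] -/
def IsSteady (ν : ℝ) (f u : UnitAddTorus d → EuclideanSpace ℝ d) : Prop :=
  ∀ w : UnitAddTorus d → EuclideanSpace ℝ d, IsSmooth w → IsDivFree w → HasZeroMean w →
    ∫ x, ⟪ν • laplacian u x - convect u u x + f x, w x⟫_ℝ = 0

/-- FLOOR and CEILING with constants `ε₀, E` for all smooth steady states at viscosities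
`ν ∈ (0, ν₀)`. [folklore] -/
def LoudBounded (f : UnitAddTorus d → EuclideanSpace ℝ d) (ε₀ E ν₀ : ℝ) : Prop :=
  ∀ ν : ℝ, 0 < ν → ν < ν₀ → ∀ u : UnitAddTorus d → EuclideanSpace ℝ d,
    IsSmooth u → IsDivFree u → HasZeroMean u → IsSteady ν f u →
      ε₀ ≤ ν * gradNormSq u ∧ ∫ x, ‖u x‖ ^ 2 ≤ E

/-- The body of the crux for a given force: some `ε₀ > 0`, `E`, `ν₀ > 0` with `LoudBounded`. [folklore] -/
def Body (f : UnitAddTorus d → EuclideanSpace ℝ d) : Prop :=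
  ∃ ε₀ E ν₀ : ℝ, 0 < ε₀ ∧ 0 < ν₀ ∧ LoudBounded f ε₀ E ν₀

/-- An admissible force: smooth, divergence free, mean zero. [folklore] -/
def Admissible (f : UnitAddTorus d → EuclideanSpace ℝ d) : Prop :=
  IsSmooth f ∧ IsDivFree f ∧ HasZeroMean f

/-- The crux is literally `∃ f, Admissible f ∧ Body f` on `T³`. [folklore] -/
theorem crux_iff :
    SteadyStatesLoudBounded ↔
      ∃ f : UnitAddTorus (Fin 3) → EuclideanSpace ℝ (Fin 3), IsSmooth f ∧ IsDivFree f ∧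
        HasZeroMean f ∧ Body f :=
  Iff.rfl

/-! ## §1 Bridge to the tree's steady weak solutions, and existence of smooth steady states -/

/-- The item's residual pairing equals the tree's generator pairing written on the smooth
representative: `∫ ⟪νΔu − (u·∇)u + f, w⟫ = (f,w) + ν (u, Δw) + ∫ ⟪(u·∇)w, u⟫` (Green's second
identity and antisymmetry of the trilinear form). [folklore] -/
theorem residual_pairing_eq {ν : ℝ} {f u w : UnitAddTorus d → EuclideanSpace ℝ d}
    (hf : IsSmooth f) (hu : IsSmooth u) (hdiv : IsDivFree u) (hw : IsSmooth w) :
    ∫ x, ⟪ν • laplacian u x - convect u u x + f x, w x⟫_ℝ =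
      (∫ x, ⟪f x, w x⟫_ℝ) + ν * (∫ x, ⟪u x, laplacian w x⟫_ℝ) +
        ∫ x, ⟪convect u w x, u x⟫_ℝ := by
  have iL : Integrable (fun x => ⟪ν • laplacian u x, w x⟫_ℝ) volume :=
    ((hu.laplacian.smul ν).inner hw).integrable
  have iC : Integrable (fun x => ⟪convect u u x, w x⟫_ℝ) volume :=
    ((hu.convect hu).inner hw).integrable
  have iF : Integrable (fun x => ⟪f x, w x⟫_ℝ) volume := (hf.inner hw).integrable
  have iLC : Integrable (fun x => ⟪ν • laplacian u x, w x⟫_ℝ - ⟪convect u u x, w x⟫_ℝ) volume :=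
    iL.sub iC
  simp_rw [inner_add_left, inner_sub_left]
  rw [integral_add iLC iF, integral_sub iL iC]
  have hlap : ∫ x, ⟪ν • laplacian u x, w x⟫_ℝ = ν * ∫ x, ⟪u x, laplacian w x⟫_ℝ := by
    simp_rw [real_inner_smul_left, integral_const_mul]
    rw [integral_inner_laplacian_comm hu hw]
  have hconv : ∫ x, ⟪convect u u x, w x⟫_ℝ = -∫ x, ⟪convect u w x, u x⟫_ℝ := by
    rw [integral_inner_convect_eq_neg hu hdiv hu hw]
    congr 1
    exact integral_congr_ae (ae_of_all _ fun x => real_inner_comm _ _)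
  rw [hlap, hconv]
  ring

/-- The `H`-lift of a smooth divergence-free mean-zero field (its `L²` class lies in `𝒱 ⊆ H`). [folklore] -/
def toH (u : UnitAddTorus d → EuclideanSpace ℝ d) (hu : IsSmooth u) (hdiv : IsDivFree u)
    (h0 : HasZeroMean u) : energySpace d :=
  ⟨MemLp.toLp u (hu.memLp 2),
    smoothSolenoidal_subset_energySpace ⟨u, hu, hdiv, h0, MemLp.coeFn_toLp (hu.memLp 2)⟩⟩

/-- The lift represents `u` almost everywhere. [folklore] -/
theorem coe_toH_ae_eq {u : UnitAddTorus d → EuclideanSpace ℝ d} (hu : IsSmooth u)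
    (hdiv : IsDivFree u) (h0 : HasZeroMean u) :
    ((toH u hu hdiv h0 : L2T d) : UnitAddTorus d → EuclideanSpace ℝ d) =ᵐ[volume] u :=
  MemLp.coeFn_toLp (hu.memLp 2)

/-- The tree's generator pairing at the lift of a smooth field is the item's residual pairing. [folklore] -/
theorem nsGeneratorPairing_toH {ν : ℝ} {f u w : UnitAddTorus d → EuclideanSpace ℝ d}
    (hf : IsSmooth f) (hu : IsSmooth u) (hdiv : IsDivFree u) (h0 : HasZeroMean u)
    (hw : IsSmooth w) :
    nsGeneratorPairing ν f (toH u hu hdiv h0) w =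
      ∫ x, ⟪ν • laplacian u x - convect u u x + f x, w x⟫_ℝ := by
  rw [residual_pairing_eq hf hu hdiv hw, nsGeneratorPairing, inertialPairing]
  have hae := coe_toH_ae_eq hu hdiv h0
  have h1 : ∫ x, ⟪((toH u hu hdiv h0 : L2T d) : UnitAddTorus d → EuclideanSpace ℝ d) x,
      laplacian w x⟫_ℝ = ∫ x, ⟪u x, laplacian w x⟫_ℝ := by
    refine integral_congr_ae ?_
    filter_upwards [hae] with x hx
    rw [hx]
  have h2 : ∫ x, ⟪Torus.fderiv w x
        (((toH u hu hdiv h0 : L2T d) : UnitAddTorus d → EuclideanSpace ℝ d) x),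
      ((toH u hu hdiv h0 : L2T d) : UnitAddTorus d → EuclideanSpace ℝ d) x⟫_ℝ =
      ∫ x, ⟪convect u w x, u x⟫_ℝ := by
    refine integral_congr_ae ?_
    filter_upwards [hae] with x hx
    rw [hx]
    rfl
  rw [h1, h2]

/-- For smooth data the item's steady weak form is the tree's `IsSteadyWeakSolution` at the lift. [folklore] -/
theorem isSteady_iff_isSteadyWeakSolution {ν : ℝ} {f u : UnitAddTorus d → EuclideanSpace ℝ d}
    (hf : IsSmooth f) (hu : IsSmooth u) (hdiv : IsDivFree u) (h0 : HasZeroMean u) :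
    IsSteady ν f u ↔ IsSteadyWeakSolution ν f (toH u hu hdiv h0) := by
  constructor
  · intro h w hw hwd hw0
    rw [nsGeneratorPairing_toH hf hu hdiv h0 hw]
    exact h w hw hwd hw0
  · intro h w hw hwd hw0
    rw [← nsGeneratorPairing_toH hf hu hdiv h0 hw]
    exact h w hw hwd hw0

/-- A smooth weakly divergence-free field on the torus is divergence free (smooth Helmholtz
decomposition `v = w₀ + ∇φ₀`; testing against `∇φ₀` kills the gradient part). [folklore] -/
theorem isDivFree_of_isWeaklyDivFree {v : UnitAddTorus d → EuclideanSpace ℝ d} (hv : IsSmooth v)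
    (hw : IsWeaklyDivFree v) : IsDivFree v := by
  obtain ⟨w₀, φ₀, hw₀, hφ₀, hdiv₀, -, hdec⟩ := smooth_helmholtz_holds (d := d) v hv
  have hg := hφ₀.gradient
  -- `∫ ⟪v, ∇φ₀⟫ = 0` and `∫ ⟪w₀, ∇φ₀⟫ = 0`, hence `∫ ‖∇φ₀‖² = 0`
  have h1 : ∫ x, ⟪v x, Torus.gradient φ₀ x⟫_ℝ = 0 := hw φ₀ hφ₀
  have h2 : ∫ x, ⟪w₀ x, Torus.gradient φ₀ x⟫_ℝ = 0 := by
    have := integral_inner_gradient_eq_zero_of_isDivFree hw₀ hφ₀ hdiv₀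
    rw [← this]
    exact integral_congr_ae (ae_of_all _ fun x => real_inner_comm _ _)
  have hv_eq : v = fun x => w₀ x + Torus.gradient φ₀ x := funext hdec
  have h3 : ∫ x, ‖Torus.gradient φ₀ x‖ ^ 2 = 0 := by
    have hsplit : ∫ x, ⟪v x, Torus.gradient φ₀ x⟫_ℝ =
        (∫ x, ⟪w₀ x, Torus.gradient φ₀ x⟫_ℝ) + ∫ x, ‖Torus.gradient φ₀ x‖ ^ 2 := by
      rw [hv_eq]
      simp_rw [inner_add_left, real_inner_self_eq_norm_sq]
      exact integral_add (hw₀.inner hg).integrable hg.norm_sq.integrable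
    linarith
  have hae : (fun x => ‖Torus.gradient φ₀ x‖ ^ 2) =ᵐ[volume] 0 :=
    (integral_eq_zero_iff_of_nonneg (f := fun x => ‖Torus.gradient φ₀ x‖ ^ 2)
      (fun x => sq_nonneg _) hg.norm_sq.integrable).1 h3
  have heq : (fun x => ‖Torus.gradient φ₀ x‖ ^ 2) = 0 :=
    (Continuous.ae_eq_iff_eq volume (hg.continuous.norm.pow 2) continuous_const).1 hae
  have hgrad0 : ∀ x, Torus.gradient φ₀ x = 0 := by
    intro x
    have hx := congrFun heq x
    simp only [Pi.zero_apply, ne_eq, OfNat.ofNat_ne_zero, not_false_eq_true, pow_eq_zero_iff,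
      norm_eq_zero] at hx
    exact hx
  have hvw : v = w₀ := by
    rw [hv_eq]; funext x; rw [hgrad0 x, add_zero]
  rw [hvw]
  exact hdiv₀

/-- **Existence of smooth steady states in the item's sense** (`#d ≤ 3`, `ν > 0`, `f` smooth):
Temam's existence theorem (`Temam1979_exists_steadyWeakSolution_holds`), his regularity theorem
(`Torus.Temam1979_steadyWeakSolution_smooth_holds`), the intrinsic description of `H`
(`mem_energySpace_iff_holds`: weakly divergence free and mean zero) transported to the smooth
representative, and the bridge `isSteady_iff_isSteadyWeakSolution`.  Hence the `∀ u` of the crux is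
never vacuous. [folklore] -/
theorem exists_isSteady (hd : Fintype.card d ≤ 3) {ν : ℝ} (hν : 0 < ν)
    {f : UnitAddTorus d → EuclideanSpace ℝ d} (hf : IsSmooth f) :
    ∃ u : UnitAddTorus d → EuclideanSpace ℝ d,
      IsSmooth u ∧ IsDivFree u ∧ HasZeroMean u ∧ IsSteady ν f u := by
  obtain ⟨U, v, hU, hv, hUv⟩ := exists_smooth_steadyWeakSolution
    Temam1979_exists_steadyWeakSolution_holds Torus.Temam1979_steadyWeakSolution_smooth_holds
    hd hν hf (hf.memLp 2)
  have hmem := (mem_energySpace_iff_holds (d := d) (U : L2T d)).1 U.2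
  -- transport weak divergence-freeness and zero mean along `U =ᵐ v`
  have hvw : IsWeaklyDivFree v := by
    intro θ hθ
    have h := hmem.1 θ hθ
    rw [← h]
    refine integral_congr_ae ?_
    filter_upwards [hUv] with x hx
    rw [hx]
  have hv0 : HasZeroMean v := by
    have h := hmem.2
    unfold HasZeroMean at h ⊢
    rw [← h]
    exact integral_congr_ae hUv.symm
  have hvdiv : IsDivFree v := isDivFree_of_isWeaklyDivFree hv hvw
  refine ⟨v, hv, hvdiv, hv0, ?_⟩
  -- the lift of `v` is `U` (same `L²` class), so the weak formulation transfers
  rw [isSteady_iff_isSteadyWeakSolution hf hv hvdiv hv0]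
  have hclass : (toH v hv hvdiv hv0 : L2T d) = (U : L2T d) :=
    Lp.ext ((coe_toH_ae_eq hv hvdiv hv0).trans hUv.symm)
  have hUeq : toH v hv hvdiv hv0 = U := Subtype.ext hclass
  rw [hUeq]
  exact hU


/-! ## §2 Elementary calculus of the residual: zero field, reflection `u ↦ -u`, scaling -/

omit [Fintype d] in
/-- Partial derivatives of a constant vanish. [folklore] -/
theorem partialDeriv_const' {F : Type*} [NormedAddCommGroup F] [NormedSpace ℝ F] (c : F) (i : d)
    (x : UnitAddTorus d) : partialDeriv i (fun _ : UnitAddTorus d => c) x = 0 := by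
  simp [Torus.partialDeriv, Torus.lineDeriv]

/-- The Laplacian of the zero field vanishes. [folklore] -/
theorem laplacian_zero' {F : Type*} [NormedAddCommGroup F] [NormedSpace ℝ F] (x : UnitAddTorus d) :
    laplacian (fun _ : UnitAddTorus d => (0 : F)) x = 0 := by
  rw [laplacian_eq_sum_partialDeriv_partialDeriv (isSmooth_const (0 : F))]
  refine Finset.sum_eq_zero fun i _ => ?_
  have h : partialDeriv i (fun _ : UnitAddTorus d => (0 : F)) = fun _ => 0 :=
    funext fun y => partialDeriv_const' (0 : F) i y
  rw [h, partialDeriv_const']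

omit [Fintype d] [DecidableEq d] in
/-- The convective derivative along the zero field vanishes. [folklore] -/
theorem convect_zero_left {F : Type*} [NormedAddCommGroup F] [NormedSpace ℝ F]
    (v : UnitAddTorus d → F) (x : UnitAddTorus d) :
    convect (fun _ : UnitAddTorus d => (0 : EuclideanSpace ℝ d)) v x = 0 := by
  simp [Torus.convect]

/-- The zero field is divergence free. [folklore] -/
theorem isDivFree_zero' : IsDivFree (fun _ : UnitAddTorus d => (0 : EuclideanSpace ℝ d)) := by
  intro x
  simp only [Torus.divergence]
  refine Finset.sum_eq_zero fun i _ => ?_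
  exact partialDeriv_const' (0 : ℝ) i x

omit [DecidableEq d] in
/-- The zero field has zero mean. [folklore] -/
theorem hasZeroMean_zero' {F : Type*} [NormedAddCommGroup F] [NormedSpace ℝ F] :
    HasZeroMean (fun _ : UnitAddTorus d => (0 : F)) := by
  simp [HasZeroMean]

/-- `‖∇0‖² = 0`. [folklore] -/
theorem gradNormSq_zero' : gradNormSq (fun _ : UnitAddTorus d => (0 : EuclideanSpace ℝ d)) = 0 := by
  simp [gradNormSq, partialDeriv_const']

/-- **`u = 0` is a steady state of the unforced system** at every viscosity. [folklore] -/
theorem isSteady_zero (ν : ℝ) :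
    IsSteady ν (fun _ : UnitAddTorus d => (0 : EuclideanSpace ℝ d)) (fun _ => 0) := by
  intro w _ _ _
  simp [laplacian_zero']

omit [Fintype d] [DecidableEq d] in
/-- `-u = (-1) • u` as functions. [folklore] -/
theorem neg_eq_neg_one_smul' {F : Type*} [NormedAddCommGroup F] [NormedSpace ℝ F]
    (u : UnitAddTorus d → F) : (-u) = ((-1 : ℝ) • u) := by
  funext x; simp

omit [DecidableEq d] in
/-- Scaling of the convective term: `((cu)·∇)(cu) = c² (u·∇)u` for `C¹` `u`. [folklore] -/
theorem convect_smul_smul {u : UnitAddTorus d → EuclideanSpace ℝ d} (hu : IsContDiff 1 u) (c : ℝ)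
    (x : UnitAddTorus d) : convect (c • u) (c • u) x = (c * c) • convect u u x := by
  simp only [Torus.convect]
  rw [fderiv_const_smul hu c x]
  simp [smul_smul]

omit [DecidableEq d] in
/-- Scaling of the Laplacian: `Δ(cu) = c Δu` for smooth `u`. [folklore] -/
theorem laplacian_smul' {F : Type*} [NormedAddCommGroup F] [NormedSpace ℝ F] {u : UnitAddTorus d → F}
    (hu : IsSmooth u) (c : ℝ) (x : UnitAddTorus d) : laplacian (c • u) x = c • laplacian u x := by
  rw [Torus.laplacian, Torus.laplacian,
    show liftAt (c • u) x = c • liftAt u x from rfl,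
    InnerProductSpace.laplacian_smul c
      ((hu.isContDiff (n := 2) (WithTop.coe_le_coe.mpr le_top)).liftAt x).contDiffAt]

omit [Fintype d] in
/-- Partial derivatives are homogeneous. [folklore] -/
theorem partialDeriv_smul' {F : Type*} [NormedAddCommGroup F] [NormedSpace ℝ F]
    (u : UnitAddTorus d → F) (c : ℝ) (i : d) (x : UnitAddTorus d) :
    partialDeriv i (c • u) x = c • partialDeriv i u x := by
  simp only [Torus.partialDeriv, Torus.lineDeriv, Pi.smul_apply]
  exact deriv_fun_const_smul_field c (fun t : ℝ => u (x + proj (t • EuclideanSpace.single i (1 : ℝ))))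

/-- Scaling of the divergence-free condition. [folklore] -/
theorem isDivFree_smul {u : UnitAddTorus d → EuclideanSpace ℝ d} (hdiv : IsDivFree u) (c : ℝ) :
    IsDivFree (c • u) := by
  intro x
  have hx := hdiv x
  simp only [Torus.divergence] at hx ⊢
  have h : ∀ i, (fun y => (c • u) y i) = c • fun y => u y i := by
    intro i; funext y; simp
  simp_rw [h, partialDeriv_smul', smul_eq_mul, ← Finset.mul_sum, hx, mul_zero]

omit [DecidableEq d] in
/-- Scaling of the zero-mean condition. [folklore] -/
theorem hasZeroMean_smul {F : Type*} [NormedAddCommGroup F] [NormedSpace ℝ F]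
    {u : UnitAddTorus d → F} (h0 : HasZeroMean u) (c : ℝ) : HasZeroMean (c • u) := by
  unfold HasZeroMean at h0 ⊢
  rw [show (fun x => (c • u) x) = fun x => c • u x from rfl, integral_smul, h0, smul_zero]

/-- Scaling of the squared gradient norm: `‖∇(cu)‖² = c² ‖∇u‖²`. [folklore] -/
theorem gradNormSq_smul' (u : UnitAddTorus d → EuclideanSpace ℝ d) (c : ℝ) :
    gradNormSq (c • u) = c ^ 2 * gradNormSq u := by
  unfold gradNormSq
  rw [← integral_const_mul]
  refine integral_congr_ae (ae_of_all _ fun x => ?_)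
  simp only [partialDeriv_smul', norm_smul, mul_pow, Real.norm_eq_abs, sq_abs, Finset.mul_sum]

/-- **Reflection symmetry of the steady equation**: if `u` is a steady state at viscosity `ν`
then `-u` is a steady state at viscosity `-ν` (the residual is invariant: `(-ν)Δ(-u) = νΔu`,
`((-u)·∇)(-u) = (u·∇)u`). [folklore] -/
theorem isSteady_neg_neg {ν : ℝ} {f u : UnitAddTorus d → EuclideanSpace ℝ d} (hu : IsSmooth u)
    (hs : IsSteady ν f u) : IsSteady (-ν) f (-u) := by
  intro w hw hwd hw0
  have hres : ∀ x, (-ν) • laplacian (-u) x - convect (-u) (-u) x + f x =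
      ν • laplacian u x - convect u u x + f x := by
    intro x
    rw [neg_eq_neg_one_smul' u, laplacian_smul' hu, convect_smul_smul (hu.isContDiff (by simp))]
    simp
  simp_rw [hres]
  exact hs w hw hwd hw0

/-! ## §3 The energy identity and the two basic inequalities (Young, Poincaré) -/

/-- **Energy identity at a smooth steady state**: `ν ‖∇u‖² = (f, u)` (test the weak form with
`w = u`; `∫⟪u, Δu⟫ = -‖∇u‖²`, `∫⟪(u·∇)u, u⟫ = 0`). [folklore] -/
theorem energy_identity {ν : ℝ} {f u : UnitAddTorus d → EuclideanSpace ℝ d} (hf : IsSmooth f)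
    (hu : IsSmooth u) (hdiv : IsDivFree u) (h0 : HasZeroMean u) (hs : IsSteady ν f u) :
    ν * gradNormSq u = ∫ x, ⟪f x, u x⟫_ℝ := by
  have h := hs u hu hdiv h0
  rw [residual_pairing_eq hf hu hdiv hu, integral_inner_laplacian_eq_neg_holds hu,
    integral_inner_convect_self_eq_zero hu hdiv] at h
  have hG : gradNormSq u = ∑ i, ∫ x, ‖partialDeriv i u x‖ ^ 2 := by
    unfold gradNormSq
    exact integral_finsetSum _ fun i _ => (hu.partialDeriv i).norm_sq.integrable
  rw [hG]
  linarith

omit [Fintype d] [DecidableEq d] in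
/-- Pointwise weighted Young inequality `⟪x, y⟫ ≤ α‖x‖² + β‖y‖²` whenever `α > 0` and
`4αβ ≥ 1`. [folklore] -/
theorem inner_le_young {F : Type*} [NormedAddCommGroup F] [InnerProductSpace ℝ F] (x y : F)
    {α β : ℝ} (hα : 0 < α) (hαβ : 1 ≤ 4 * α * β) :
    ⟪x, y⟫_ℝ ≤ α * ‖x‖ ^ 2 + β * ‖y‖ ^ 2 := by
  have h1 : ⟪x, y⟫_ℝ ≤ ‖x‖ * ‖y‖ := real_inner_le_norm _ _
  have h2 : ‖x‖ * ‖y‖ ≤ α * ‖x‖ ^ 2 + β * ‖y‖ ^ 2 := by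
    nlinarith [sq_nonneg (2 * α * ‖x‖ - ‖y‖), mul_nonneg (sub_nonneg.2 hαβ) (sq_nonneg ‖y‖),
      norm_nonneg x, norm_nonneg y]
  exact h1.trans h2

omit [DecidableEq d] in
/-- Integrated weighted Young inequality for smooth fields:
`∫⟪a, b⟫ ≤ α ∫‖a‖² + β ∫‖b‖²` (`α > 0`, `4αβ ≥ 1`). [folklore] -/
theorem integral_inner_le_young {F : Type*} [NormedAddCommGroup F] [InnerProductSpace ℝ F]
    {a b : UnitAddTorus d → F} (ha : IsSmooth a) (hb : IsSmooth b) {α β : ℝ} (hα : 0 < α)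
    (hαβ : 1 ≤ 4 * α * β) :
    ∫ x, ⟪a x, b x⟫_ℝ ≤ α * (∫ x, ‖a x‖ ^ 2) + β * (∫ x, ‖b x‖ ^ 2) := by
  rw [← integral_const_mul, ← integral_const_mul,
    ← integral_add (ha.norm_sq.integrable.const_mul _) (hb.norm_sq.integrable.const_mul _)]
  exact integral_mono (ha.inner hb).integrable
    ((ha.norm_sq.integrable.const_mul _).add (hb.norm_sq.integrable.const_mul _))
    fun x => inner_le_young (a x) (b x) hα hαβ

/-- **Poincaré inequality for smooth mean-zero fields** on the unit torus (first eigenvalue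
`4π²`): `4π² ∫‖v‖² ≤ ‖∇v‖²` (spectral Poincaré of the tree,
`ofReal_integral_norm_sq_le_eGradNormSq_add`, with `∫ v = 0` and the identification of the
spectral and derivative gradient norms on smooth fields). [folklore] -/
theorem poincare {v : UnitAddTorus d → EuclideanSpace ℝ d} (hv : IsSmooth v) (h0 : HasZeroMean v) :
    4 * Real.pi ^ 2 * ∫ x, ‖v x‖ ^ 2 ≤ gradNormSq v := by
  have h := ofReal_integral_norm_sq_le_eGradNormSq_add (hv.memLp 2)
  rw [show (∫ x, v x) = 0 from h0, norm_zero, zero_pow two_ne_zero, mul_zero, ENNReal.ofReal_zero,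
    add_zero, eGradNormSq_eq_ofReal_gradNormSq hv] at h
  exact (ENNReal.ofReal_le_ofReal_iff (gradNormSq_nonneg v)).1 h

/-- **A priori bound on the dissipation of every steady state**: `ν ‖∇u‖² ≤ ‖f‖²/(4π²ν)`
(energy identity, Young with weights `1/(8π²ν)`, `2π²ν`, Poincaré). In particular the FLOOR `ε₀`
is impossible at every steady state once `ν > ‖f‖²/(4π²ε₀)`. [folklore] -/
theorem dissipation_le {ν : ℝ} (hν : 0 < ν) {f u : UnitAddTorus d → EuclideanSpace ℝ d}
    (hf : IsSmooth f) (hu : IsSmooth u) (hdiv : IsDivFree u) (h0 : HasZeroMean u)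
    (hs : IsSteady ν f u) :
    ν * gradNormSq u ≤ (∫ x, ‖f x‖ ^ 2) / (4 * Real.pi ^ 2 * ν) := by
  have hπ : 0 < 4 * Real.pi ^ 2 := by positivity
  set C : ℝ := 1 / (4 * Real.pi ^ 2 * ν) with hC
  have hC0 : 0 < C := by positivity
  have hαβ : 1 ≤ 4 * (C / 2) * (2 * Real.pi ^ 2 * ν) := by
    apply le_of_eq
    rw [hC]
    field_simp
  have hE := energy_identity hf hu hdiv h0 hs
  have hY := integral_inner_le_young hf hu (by positivity : 0 < C / 2) hαβ
  have hP := poincare hu h0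
  have hP' : ν * (4 * Real.pi ^ 2 * ∫ x, ‖u x‖ ^ 2) ≤ ν * gradNormSq u :=
    mul_le_mul_of_nonneg_left hP hν.le
  have h3 : ν * gradNormSq u ≤ C * ∫ x, ‖f x‖ ^ 2 := by nlinarith
  calc ν * gradNormSq u ≤ C * ∫ x, ‖f x‖ ^ 2 := h3
    _ = (∫ x, ‖f x‖ ^ 2) / (4 * Real.pi ^ 2 * ν) := by rw [hC]; ring

/-! ## §4 Load-bearing hypotheses: which clauses of the crux carry weight -/

/-- `Body 0` is false in every dimension: `u = 0` is a quiet steady state of the unforced system,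
so the FLOOR forces the prover's `f` to be nonzero. [folklore] -/
theorem not_body_zero : ¬ Body (fun _ : UnitAddTorus d => (0 : EuclideanSpace ℝ d)) := by
  rintro ⟨ε₀, E, ν₀, hε₀, hν₀, h⟩
  have h1 := (h (ν₀ / 2) (by positivity) (by linarith) (fun _ => 0) (isSmooth_const _)
    isDivFree_zero' hasZeroMean_zero' (isSteady_zero _)).1
  rw [gradNormSq_zero', mul_zero] at h1
  linarith

/-- Consequently any witness force of the crux is not the zero field. [folklore] -/
theorem force_ne_zero_of_body {f : UnitAddTorus d → EuclideanSpace ℝ d} (hB : Body f) :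
    f ≠ fun _ => 0 := by
  rintro rfl
  exact not_body_zero hB

/-- **`0 < ν` is load-bearing** (the crux with the sign condition `0 < ν` DROPPED is false, and
false for EVERY `f`): reflect a steady state `u` of `NS₁(f)` (Temam existence + regularity) to the
steady state `-u` at viscosity `-1 < ν₀`, where the FLOOR reads `ε₀ ≤ -‖∇u‖² ≤ 0`. [folklore] -/
theorem cruxWithoutNuPos_false :
    ¬ ∃ f : UnitAddTorus (Fin 3) → EuclideanSpace ℝ (Fin 3), IsSmooth f ∧ IsDivFree f ∧
        HasZeroMean f ∧ ∃ ε₀ E ν₀ : ℝ, 0 < ε₀ ∧ 0 < ν₀ ∧ ∀ ν : ℝ, ν < ν₀ →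
          ∀ u : UnitAddTorus (Fin 3) → EuclideanSpace ℝ (Fin 3), IsSmooth u → IsDivFree u →
            HasZeroMean u → IsSteady ν f u → ε₀ ≤ ν * gradNormSq u ∧ ∫ x, ‖u x‖ ^ 2 ≤ E := by
  rintro ⟨f, hf, -, -, ε₀, E, ν₀, hε₀, hν₀, h⟩
  obtain ⟨u, hu, hdiv, h0, hs⟩ := exists_isSteady (d := Fin 3) (by simp) one_pos hf
  have hs' : IsSteady (-1) f (-u) := isSteady_neg_neg hu hs
  have hdiv' : IsDivFree (-u) := by rw [neg_eq_neg_one_smul']; exact isDivFree_smul hdiv _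
  have h0' : HasZeroMean (-u) := by rw [neg_eq_neg_one_smul']; exact hasZeroMean_smul h0 _
  have h1 := (h (-1) (by linarith) (-u) hu.neg hdiv' h0' hs').1
  have hG := gradNormSq_nonneg (-u)
  linarith

/-- **`ν < ν₀` is load-bearing** (the crux with the smallness condition DROPPED — all `ν > 0` —
is false, for EVERY `f`): at large viscosity every steady state has
`ν‖∇u‖² ≤ ‖f‖²/(4π²ν) < ε₀` (`dissipation_le`), and steady states exist (`exists_isSteady`). [folklore] -/
theorem cruxWithoutNuLt_false :
    ¬ ∃ f : UnitAddTorus (Fin 3) → EuclideanSpace ℝ (Fin 3), IsSmooth f ∧ IsDivFree f ∧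
        HasZeroMean f ∧ ∃ ε₀ E : ℝ, 0 < ε₀ ∧ ∀ ν : ℝ, 0 < ν →
          ∀ u : UnitAddTorus (Fin 3) → EuclideanSpace ℝ (Fin 3), IsSmooth u → IsDivFree u →
            HasZeroMean u → IsSteady ν f u → ε₀ ≤ ν * gradNormSq u ∧ ∫ x, ‖u x‖ ^ 2 ≤ E := by
  rintro ⟨f, hf, -, -, ε₀, E, hε₀, h⟩
  have hA0 : 0 ≤ ∫ x, ‖f x‖ ^ 2 := integral_nonneg fun _ => sq_nonneg _
  have hπ : 0 < 4 * Real.pi ^ 2 := by positivity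
  -- a viscosity so large that `‖f‖²/(4π²ν) < ε₀`
  obtain ⟨ν, hν, hν'⟩ : ∃ ν : ℝ, 0 < ν ∧ (∫ x, ‖f x‖ ^ 2) / (4 * Real.pi ^ 2 * ν) < ε₀ := by
    refine ⟨(∫ x, ‖f x‖ ^ 2) / (4 * Real.pi ^ 2 * ε₀) + 1, by positivity, ?_⟩
    rw [div_lt_iff₀ (by positivity)]
    have h1 : ε₀ * (4 * Real.pi ^ 2 * ((∫ x, ‖f x‖ ^ 2) / (4 * Real.pi ^ 2 * ε₀) + 1)) =
        (∫ x, ‖f x‖ ^ 2) + 4 * Real.pi ^ 2 * ε₀ := by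
      field_simp
    nlinarith
  obtain ⟨u, hu, hdiv, h0, hs⟩ := exists_isSteady (d := Fin 3) (by simp) hν hf
  have h1 := (h ν hν u hu hdiv h0 hs).1
  have h2 := dissipation_le hν hf hu hdiv h0 hs
  linarith

/-- **`0 < ε₀` is what makes the crux non-trivial**: the crux with `0 < ε₀` DROPPED is TRUE,
witnessed by `f = 0`, `ε₀ = E = 0` (every steady state of the unforced system has
`ν‖∇u‖² = (0,u) = 0`, hence `u = 0` by Poincaré).  So the CEILING alone is trivially
certifiable; all difficulty sits in the FLOOR (equivalently: in being forced to take `f ≠ 0`). [folklore] -/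
theorem cruxWithoutEpsPos_true :
    ∃ f : UnitAddTorus (Fin 3) → EuclideanSpace ℝ (Fin 3), IsSmooth f ∧ IsDivFree f ∧
        HasZeroMean f ∧ ∃ ε₀ E ν₀ : ℝ, 0 < ν₀ ∧ LoudBounded f ε₀ E ν₀ := by
  refine ⟨fun _ => 0, isSmooth_const _, isDivFree_zero', hasZeroMean_zero', 0, 0, 1, one_pos, ?_⟩
  intro ν hν _ u hu hdiv h0 hs
  have hE := energy_identity (isSmooth_const _) hu hdiv h0 hs
  simp only [inner_zero_left, integral_zero] at hE
  have hG : gradNormSq u = 0 := by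
    rcases mul_eq_zero.1 hE with h | h
    · exact absurd h hν.ne'
    · exact h
  have hP := poincare hu h0
  have hπ : 0 < 4 * Real.pi ^ 2 := by positivity
  have hU0 : 0 ≤ ∫ x, ‖u x‖ ^ 2 := integral_nonneg fun _ => sq_nonneg _
  have hU : ∫ x, ‖u x‖ ^ 2 ≤ 0 := by
    by_contra hcon
    have : 0 < 4 * Real.pi ^ 2 * ∫ x, ‖u x‖ ^ 2 := mul_pos hπ (lt_of_not_ge hcon)
    linarith
  exact ⟨by rw [hG, mul_zero], hU⟩

/-- **`0 < ν₀` only excludes the vacuous witness** `ν₀ = 0` (the crux with `0 < ν₀` DROPPED is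
true with an empty range of viscosities). [folklore] -/
theorem cruxWithoutNu0Pos_true :
    ∃ f : UnitAddTorus (Fin 3) → EuclideanSpace ℝ (Fin 3), IsSmooth f ∧ IsDivFree f ∧
        HasZeroMean f ∧ ∃ ε₀ E ν₀ : ℝ, 0 < ε₀ ∧ LoudBounded f ε₀ E ν₀ :=
  ⟨fun _ => 0, isSmooth_const _, isDivFree_zero', hasZeroMean_zero', 1, 0, 0, one_pos,
    fun _ hν hν0 => absurd (hν.trans hν0) (lt_irrefl _)⟩

/-! ## §5 Dimension is load-bearing: the two-dimensional crux is false for EVERY force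

On `T²` the enstrophy balance `ν‖ΔV‖² = -(ΔF, V)` (test the steady equation with `w = ΔV`,
admissible, and use the two-dimensional orthogonality `∫⟪ΔV,(V·∇)V⟫ = 0`) together with
`‖∇V‖² = -(V, ΔV)` squeezes the dissipation: `ν‖∇V‖² ≤ (νT/2)‖V‖² + (1/2T)(ν‖ΔV‖²)` for every
`T > 0`, so FLOOR and CEILING cannot hold simultaneously as `ν → 0`.  This is the steady-state
shadow of the Alexakis–Doering barrier, here for ALL smooth forces and with no appeal to
time averages. -/

/-- `‖∇u‖² = -∫⟪u, Δu⟫` for smooth `u`. [folklore] -/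
theorem gradNormSq_eq_neg_integral {u : UnitAddTorus d → EuclideanSpace ℝ d} (hu : IsSmooth u) :
    gradNormSq u = -∫ x, ⟪u x, laplacian u x⟫_ℝ := by
  rw [integral_inner_laplacian_eq_neg_holds hu, neg_neg]
  unfold gradNormSq
  exact integral_finsetSum _ fun i _ => (hu.partialDeriv i).norm_sq.integrable

/-- The Laplacian of a smooth field has zero mean (`Δu = ∑ⱼ ∂ⱼ(∂ⱼu)` and `∫ ∂ⱼ(·) = 0`). [folklore] -/
theorem hasZeroMean_laplacian {F : Type*} [NormedAddCommGroup F] [NormedSpace ℝ F] [CompleteSpace F]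
    {u : UnitAddTorus d → F} (hu : IsSmooth u) : HasZeroMean (laplacian u) := by
  unfold HasZeroMean
  have h : (fun x => laplacian u x) = fun x => ∑ j, partialDeriv j (partialDeriv j u) x :=
    funext fun x => laplacian_eq_sum_partialDeriv_partialDeriv hu x
  rw [show (∫ x, laplacian u x) = ∫ x, (fun x => laplacian u x) x from rfl, h,
    integral_finsetSum _ fun j _ => ((hu.partialDeriv j).partialDeriv j).integrable]
  exact Finset.sum_eq_zero fun j _ => integral_partialDeriv_eq_zero_holds (hu.partialDeriv j) j

/-- **The Laplacian of a smooth divergence-free field is divergence free**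
(`div Δu = ∑ⱼ ∂ⱼ∂ⱼ (div u)` after commuting partial derivatives). [folklore] -/
theorem isDivFree_laplacian {u : UnitAddTorus d → EuclideanSpace ℝ d} (hu : IsSmooth u)
    (hdiv : IsDivFree u) : IsDivFree (laplacian u) := by
  intro x
  have hu1 : IsContDiff 1 u := hu.isContDiff (by simp)
  have hc : ∀ i, IsSmooth (fun y => u y i) := fun i => hu.apply i
  -- components of the Laplacian are Laplacians of components, written as iterated partials
  have hcomp : ∀ i, (fun y => laplacian u y i) =
      fun y => ∑ j, partialDeriv j (partialDeriv j (fun z => u z i)) y := by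
    intro i; funext y
    rw [laplacian_eq_sum_partialDeriv_partialDeriv hu y, WithLp.ofLp_sum, Finset.sum_apply]
    refine Finset.sum_congr rfl fun j _ => ?_
    have h1 : (fun z => partialDeriv j u z i) = partialDeriv j (fun z => u z i) :=
      funext fun z => (partialDeriv_apply_coord hu1 j z i).symm
    rw [← partialDeriv_apply_coord ((hu.partialDeriv j).isContDiff (by simp)) j y i, h1]
  simp only [Torus.divergence, hcomp]
  -- `∂ᵢ ∑ⱼ ∂ⱼ∂ⱼ uᵢ = ∑ⱼ ∂ⱼ∂ⱼ ∂ᵢuᵢ`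
  have hsw : ∀ i, partialDeriv i (fun y => ∑ j, partialDeriv j (partialDeriv j (fun z => u z i)) y) x =
      ∑ j, partialDeriv j (partialDeriv j (partialDeriv i (fun z => u z i))) x := by
    intro i
    rw [partialDeriv_finset_sum _ (fun j _ =>
      (((hc i).partialDeriv j).partialDeriv j).isContDiff (by simp)) i x]
    refine Finset.sum_congr rfl fun j _ => ?_
    rw [partialDeriv_comm ((hc i).partialDeriv j) i j x]
    congr 1
    funext y
    exact partialDeriv_comm (hc i) i j y
  simp only [hsw]
  rw [Finset.sum_comm]
  -- `∑ⱼ ∂ⱼ∂ⱼ (∑ᵢ ∂ᵢuᵢ) = 0` since `div u = 0`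
  have hdiv0 : (fun y => ∑ i, partialDeriv i (fun z => u z i) y) = fun _ => (0 : ℝ) :=
    funext fun y => hdiv y
  have hsum : ∀ j, ∑ i, partialDeriv j (partialDeriv j (partialDeriv i (fun z => u z i))) x =
      partialDeriv j (partialDeriv j (fun y => ∑ i, partialDeriv i (fun z => u z i) y)) x := by
    intro j
    have h2 : partialDeriv j (fun y => ∑ i, partialDeriv i (fun z => u z i) y) =
        fun y => ∑ i, partialDeriv j (partialDeriv i (fun z => u z i)) y := by
      funext y
      exact partialDeriv_finset_sum _ (fun i _ => ((hc i).partialDeriv i).isContDiff (by simp)) j y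
    rw [h2, partialDeriv_finset_sum _ (fun i _ =>
      (((hc i).partialDeriv i).partialDeriv j).isContDiff (by simp)) j x]
  simp only [hsum, hdiv0]
  refine Finset.sum_eq_zero fun j _ => ?_
  have h3 : partialDeriv j (fun _ : UnitAddTorus d => (0 : ℝ)) = fun _ => 0 :=
    funext fun y => partialDeriv_const' (0 : ℝ) j y
  rw [h3, partialDeriv_const']

/-- **Enstrophy balance of a two-dimensional smooth steady state**: `ν ∫‖ΔV‖² = -∫⟪ΔF, V⟫`
(test with `w = ΔV`; the trilinear term vanishes by the two-dimensional orthogonality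
`Torus.integral_inner_laplacian_convect_self_eq_zero`, FMRT 2001 App. II.A (A.62)). [folklore] -/
theorem enstrophy_balance_fin_two {ν : ℝ}
    {F V : UnitAddTorus (Fin 2) → EuclideanSpace ℝ (Fin 2)} (hF : IsSmooth F) (hV : IsSmooth V)
    (hdiv : IsDivFree V) (hs : IsSteady ν F V) :
    ν * ∫ x, ‖laplacian V x‖ ^ 2 = -∫ x, ⟪laplacian F x, V x⟫_ℝ := by
  have hL := hV.laplacian
  have h := hs (laplacian V) hL (isDivFree_laplacian hV hdiv) (hasZeroMean_laplacian hV)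
  have iL : Integrable (fun x => ⟪ν • laplacian V x, laplacian V x⟫_ℝ) volume :=
    ((hL.smul ν).inner hL).integrable
  have iC : Integrable (fun x => ⟪convect V V x, laplacian V x⟫_ℝ) volume :=
    ((hV.convect hV).inner hL).integrable
  have iF : Integrable (fun x => ⟪F x, laplacian V x⟫_ℝ) volume := (hF.inner hL).integrable
  have iLC : Integrable (fun x => ⟪ν • laplacian V x, laplacian V x⟫_ℝ -
      ⟪convect V V x, laplacian V x⟫_ℝ) volume := iL.sub iC
  simp_rw [inner_add_left, inner_sub_left] at h
  rw [integral_add iLC iF, integral_sub iL iC] at h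
  have h1 : ∫ x, ⟪ν • laplacian V x, laplacian V x⟫_ℝ = ν * ∫ x, ‖laplacian V x‖ ^ 2 := by
    simp_rw [real_inner_smul_left, real_inner_self_eq_norm_sq, integral_const_mul]
  have h2 : ∫ x, ⟪convect V V x, laplacian V x⟫_ℝ = 0 := by
    rw [← integral_inner_laplacian_convect_self_eq_zero hV hdiv]
    exact integral_congr_ae (ae_of_all _ fun x => real_inner_comm _ _)
  have h3 : ∫ x, ⟪F x, laplacian V x⟫_ℝ = ∫ x, ⟪laplacian F x, V x⟫_ℝ :=
    (integral_inner_laplacian_comm hF hV).symm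
  rw [h1, h2, h3] at h
  linarith

/-- **The two-dimensional crux is false for every smooth force.**  For `F : T² → ℝ²` smooth
and any `ε₀ > 0`, `E`, `ν₀ > 0` there is `ν ∈ (0, ν₀)` and a smooth steady state `V` of `NS_ν(F)`
(Temam) violating FLOOR-or-CEILING: with `G = ‖∇V‖²`, `U = ‖V‖²`, `L = ‖ΔV‖²`, `K = ‖ΔF‖²`,
Young gives `G ≤ (T/2)U + (1/2T)L` and `νL ≤ K/2 + U/2`, so under the CEILING
`νG ≤ (νT/2)E + (K + E)/(4T)`, which is `< ε₀` for `T` large and then `ν` small. [folklore] -/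
theorem not_body_fin_two {F : UnitAddTorus (Fin 2) → EuclideanSpace ℝ (Fin 2)} (hF : IsSmooth F) :
    ¬ Body F := by
  rintro ⟨ε₀, E, ν₀, hε₀, hν₀, h⟩
  set K : ℝ := ∫ x, ‖laplacian F x‖ ^ 2 with hK
  have hK0 : 0 ≤ K := integral_nonneg fun _ => sq_nonneg _
  set E' : ℝ := max E 0 with hE'
  have hE'0 : 0 ≤ E' := le_max_right _ _
  set T : ℝ := (K + E') / ε₀ + 1 with hT
  have hT0 : 0 < T := by positivity
  have hTε : T * ε₀ = K + E' + ε₀ := by rw [hT]; field_simp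
  set ν : ℝ := min (ν₀ / 2) (ε₀ / (2 * (T * E' + 1))) with hν_def
  have hν : 0 < ν := lt_min (by positivity) (by positivity)
  have hνν₀ : ν < ν₀ := (min_le_left _ _).trans_lt (by linarith)
  have hνle : ν * (T * E' + 1) ≤ ε₀ / 2 := by
    have h1 : ν ≤ ε₀ / (2 * (T * E' + 1)) := min_le_right _ _
    rw [le_div_iff₀ (by positivity)] at h1
    linarith
  obtain ⟨V, hV, hVd, hV0, hs⟩ := exists_isSteady (d := Fin 2) (by simp) hν hF
  obtain ⟨hfloor, hceil⟩ := h ν hν hνν₀ V hV hVd hV0 hs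
  have hUE : ∫ x, ‖V x‖ ^ 2 ≤ E' := hceil.trans (le_max_left _ _)
  have hL := hV.laplacian
  -- Young for `G = ∫⟪-V, ΔV⟫` with weights `T/2`, `1/(2T)`
  have hG : gradNormSq V ≤ T / 2 * (∫ x, ‖V x‖ ^ 2) + 1 / (2 * T) * (∫ x, ‖laplacian V x‖ ^ 2) := by
    have hTT : 4 * (T / 2) * (1 / (2 * T)) = 1 := by
      rw [one_div, show 4 * (T / 2) = 2 * T by ring, mul_inv_cancel₀ (by positivity)]
    have hY := integral_inner_le_young hV.neg hL (by positivity : 0 < T / 2) (le_of_eq hTT.symm)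
    have e1 : ∫ x, ⟪(-V) x, laplacian V x⟫_ℝ = -∫ x, ⟪V x, laplacian V x⟫_ℝ := by
      rw [← integral_neg]
      exact integral_congr_ae (ae_of_all _ fun x => by simp [inner_neg_left])
    have e2 : ∫ x, ‖(-V) x‖ ^ 2 = ∫ x, ‖V x‖ ^ 2 :=
      integral_congr_ae (ae_of_all _ fun x => by simp [norm_neg])
    rw [e1, e2, ← gradNormSq_eq_neg_integral hV] at hY
    exact hY
  -- Young for `νL = ∫⟪-ΔF, V⟫` with weights `1/2`, `1/2`
  have hνL : ν * (∫ x, ‖laplacian V x‖ ^ 2) ≤ 1 / 2 * K + 1 / 2 * (∫ x, ‖V x‖ ^ 2) := by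
    have hY := integral_inner_le_young hF.laplacian.neg hV (by norm_num : (0 : ℝ) < 1 / 2)
      (by norm_num : (1 : ℝ) ≤ 4 * (1 / 2) * (1 / 2))
    have e1 : ∫ x, ⟪(-laplacian F) x, V x⟫_ℝ = -∫ x, ⟪laplacian F x, V x⟫_ℝ := by
      rw [← integral_neg]
      exact integral_congr_ae (ae_of_all _ fun x => by simp [inner_neg_left])
    have e2 : ∫ x, ‖(-laplacian F) x‖ ^ 2 = K :=
      integral_congr_ae (ae_of_all _ fun x => by simp [norm_neg])
    rw [e1, e2, ← enstrophy_balance_fin_two hF hV hVd hs] at hY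
    exact hY
  -- combine
  have h1 : ν * gradNormSq V ≤ ν * (T / 2) * (∫ x, ‖V x‖ ^ 2) +
      1 / (2 * T) * (ν * ∫ x, ‖laplacian V x‖ ^ 2) := by
    calc ν * gradNormSq V
        ≤ ν * (T / 2 * (∫ x, ‖V x‖ ^ 2) + 1 / (2 * T) * (∫ x, ‖laplacian V x‖ ^ 2)) :=
          mul_le_mul_of_nonneg_left hG hν.le
      _ = _ := by ring
  have h2 : 1 / (2 * T) * (ν * ∫ x, ‖laplacian V x‖ ^ 2) ≤
      1 / (2 * T) * (1 / 2 * K + 1 / 2 * (∫ x, ‖V x‖ ^ 2)) :=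
    mul_le_mul_of_nonneg_left hνL (by positivity)
  have h3 : ν * (T / 2) * (∫ x, ‖V x‖ ^ 2) ≤ ν * (T / 2) * E' :=
    mul_le_mul_of_nonneg_left hUE (by positivity)
  have h4 : 1 / (2 * T) * (1 / 2 * (∫ x, ‖V x‖ ^ 2)) ≤ 1 / (2 * T) * (1 / 2 * E') :=
    mul_le_mul_of_nonneg_left (by linarith) (by positivity)
  have h5 : ν * gradNormSq V ≤ ν * (T / 2) * E' + 1 / (2 * T) * (1 / 2 * K + 1 / 2 * E') := by
    nlinarith
  -- the two numerical facts
  have h6 : 1 / (2 * T) * (1 / 2 * K + 1 / 2 * E') < ε₀ / 2 := by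
    rw [show 1 / (2 * T) * (1 / 2 * K + 1 / 2 * E') = (K + E') / (4 * T) by field_simp; ring]
    rw [div_lt_iff₀ (by positivity)]
    nlinarith
  have h7 : ν * (T / 2) * E' < ε₀ / 2 := by nlinarith
  linarith

/-- **The two-dimensional twin of the crux is false** (every admissible force fails). [folklore] -/
theorem not_cruxFinTwo :
    ¬ ∃ F : UnitAddTorus (Fin 2) → EuclideanSpace ℝ (Fin 2), IsSmooth F ∧ IsDivFree F ∧
        HasZeroMean F ∧ Body F := by
  rintro ⟨F, hF, -, -, hB⟩
  exact not_body_fin_two hF hB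

/-! ## §6 Planar (`x₃`-invariant, horizontal) forces are excluded on `T³`

A smooth steady state of the planar problem lifts to a `2½`-dimensional steady state of the
three-dimensional problem with the same energy and dissipation (pressure recovered from the
two-dimensional weak form by the smooth Helmholtz decomposition, so arbitrary three-dimensional
tests are handled); hence `Body (twoHalf F 0) → Body F`, which is impossible by §5. -/

/-- Subtracting a constant preserves divergence-freeness. [folklore] -/
theorem isDivFree_sub_const {w : UnitAddTorus d → EuclideanSpace ℝ d} (hw : IsDivFree w)
    (c : EuclideanSpace ℝ d) : IsDivFree (fun x => w x - c) := by
  intro x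
  have hx := hw x
  simp only [Torus.divergence, Torus.partialDeriv, Torus.lineDeriv, PiLp.sub_apply] at hx ⊢
  simpa [deriv_sub_const] using hx

omit [DecidableEq d] in
/-- The residual of the item's steady equation is smooth. [folklore] -/
theorem isSmooth_residual (ν : ℝ) {f u : UnitAddTorus d → EuclideanSpace ℝ d} (hf : IsSmooth f)
    (hu : IsSmooth u) : IsSmooth (fun x => ν • laplacian u x - convect u u x + f x) :=
  ((hu.laplacian.smul ν).sub (hu.convect hu)).add hf

/-- The residual has zero mean (for mean-zero `f` and divergence-free `u`). [folklore] -/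
theorem integral_residual_eq_zero (ν : ℝ) {f u : UnitAddTorus d → EuclideanSpace ℝ d}
    (hf : IsSmooth f) (hf0 : HasZeroMean f) (hu : IsSmooth u) (hdiv : IsDivFree u) :
    ∫ x, (ν • laplacian u x - convect u u x + f x) = 0 := by
  have iL : Integrable (fun x => ν • laplacian u x) volume := (hu.laplacian.smul ν).integrable
  have iC : Integrable (fun x => convect u u x) volume := (hu.convect hu).integrable
  have iLC : Integrable (fun x => ν • laplacian u x - convect u u x) volume := iL.sub iC
  rw [integral_add iLC hf.integrable, integral_sub iL iC, integral_smul,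
    show (∫ x, laplacian u x) = 0 from hasZeroMean_laplacian hu, smul_zero,
    show (∫ x, f x) = 0 from hf0]
  have hc : ∫ x, convect u u x = 0 := integral_fderiv_apply_eq_zero_of_isDivFree hu hu hdiv
  rw [hc]; simp

/-- **Pressure recovery**: a smooth steady state in the item's weak sense solves the equation
classically, `νΔu − (u·∇)u + f = ∇p` with a smooth pressure (smooth Helmholtz decomposition of
the residual; its solenoidal part is orthogonal to itself after subtracting its mean, and the
residual has zero mean). [folklore] -/
theorem exists_pressure {ν : ℝ} {f u : UnitAddTorus d → EuclideanSpace ℝ d} (hf : IsSmooth f)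
    (hf0 : HasZeroMean f) (hu : IsSmooth u) (hdiv : IsDivFree u) (hs : IsSteady ν f u) :
    ∃ p : UnitAddTorus d → ℝ, IsSmooth p ∧
      ∀ x, ν • laplacian u x - convect u u x + f x = Torus.gradient p x := by
  set R : UnitAddTorus d → EuclideanSpace ℝ d := fun x => ν • laplacian u x - convect u u x + f x
    with hRdef
  have hR : IsSmooth R := isSmooth_residual ν hf hu
  have hR0 : ∫ x, R x = 0 := integral_residual_eq_zero ν hf hf0 hu hdiv
  obtain ⟨w₀, φ₀, hw₀, hφ₀, hdiv₀, -, hdec⟩ := smooth_helmholtz_holds (d := d) R hR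
  have hg := hφ₀.gradient
  set c : EuclideanSpace ℝ d := ∫ x, w₀ x with hc
  -- the admissible test `w₀ - c`
  have hw₁ : IsSmooth (fun x => w₀ x - c) := hw₀.sub (isSmooth_const c)
  have hw₁d : IsDivFree (fun x => w₀ x - c) := isDivFree_sub_const hdiv₀ c
  have hw₁0 : HasZeroMean (fun x => w₀ x - c) := by
    unfold HasZeroMean
    rw [integral_sub hw₀.integrable (integrable_const c), integral_const, ← hc]
    simp
  have h1 : ∫ x, ⟪R x, w₀ x - c⟫_ℝ = 0 := hs _ hw₁ hw₁d hw₁0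
  have h2 : ∫ x, ⟪R x, c⟫_ℝ = 0 := by
    have h := integral_inner (𝕜 := ℝ) hR.integrable c
    rw [hR0, inner_zero_right] at h
    rw [← h]
    exact integral_congr_ae (ae_of_all _ fun x => real_inner_comm _ _)
  have h3 : ∫ x, ⟪R x, w₀ x⟫_ℝ = 0 := by
    have e : (fun x => ⟪R x, w₀ x⟫_ℝ) = fun x => ⟪R x, w₀ x - c⟫_ℝ + ⟪R x, c⟫_ℝ := by
      funext x; rw [← inner_add_right, sub_add_cancel]
    rw [e, integral_add (hR.inner hw₁).integrable (hR.inner (isSmooth_const c)).integrable, h1, h2,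
      add_zero]
  -- `∫⟪R, w₀⟫ = ∫‖w₀‖²`
  have h4 : ∫ x, ⟪R x, w₀ x⟫_ℝ = ∫ x, ‖w₀ x‖ ^ 2 := by
    have e : (fun x => ⟪R x, w₀ x⟫_ℝ) = fun x => ‖w₀ x‖ ^ 2 + ⟪Torus.gradient φ₀ x, w₀ x⟫_ℝ := by
      funext x; rw [show R x = w₀ x + Torus.gradient φ₀ x from hdec x, inner_add_left,
        real_inner_self_eq_norm_sq]
    rw [e, integral_add hw₀.norm_sq.integrable (hg.inner hw₀).integrable,
      integral_inner_gradient_eq_zero_of_isDivFree hw₀ hφ₀ hdiv₀, add_zero]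
  have h5 : ∫ x, ‖w₀ x‖ ^ 2 = 0 := by rw [← h4, h3]
  have hae : (fun x => ‖w₀ x‖ ^ 2) =ᵐ[volume] 0 :=
    (integral_eq_zero_iff_of_nonneg (f := fun x => ‖w₀ x‖ ^ 2) (fun x => sq_nonneg _)
      hw₀.norm_sq.integrable).1 h5
  have heq : (fun x => ‖w₀ x‖ ^ 2) = 0 :=
    (Continuous.ae_eq_iff_eq volume (hw₀.continuous.norm.pow 2) continuous_const).1 hae
  have hw00 : ∀ x, w₀ x = 0 := by
    intro x
    have hx := congrFun heq x
    simp only [Pi.zero_apply, ne_eq, OfNat.ofNat_ne_zero, not_false_eq_true, pow_eq_zero_iff,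
      norm_eq_zero] at hx
    exact hx
  refine ⟨φ₀, hφ₀, fun x => ?_⟩
  rw [show ν • laplacian u x - convect u u x + f x = R x from rfl, hdec x, hw00 x, zero_add]

section Planar

open Literature.Analysis.FunctionSpaces.Torus (twoHalf planarProj planarEmbed)

/-- Local notation: the flat two-torus. -/
local notation "𝕋²" => UnitAddTorus (Fin 2)
/-- Local notation: `ℝ²`. -/
local notation "E²" => EuclideanSpace ℝ (Fin 2)

/-- The zero scalar on `T²` is smooth. [folklore] -/
theorem isSmooth_zero_scalar : IsSmooth (0 : 𝕋² → ℝ) := isSmooth_const (0 : ℝ)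

/-- The zero planar field is smooth. [folklore] -/
theorem isSmooth_zero_planar : IsSmooth (0 : 𝕋² → E²) := isSmooth_const (0 : E²)

/-- `Δ0 = 0` (scalar). [folklore] -/
theorem laplacian_zero_scalar (y : 𝕋²) : laplacian (0 : 𝕋² → ℝ) y = 0 := laplacian_zero' y

/-- `Δ0 = 0` (planar field). [folklore] -/
theorem laplacian_zero_planar (y : 𝕋²) : laplacian (0 : 𝕋² → E²) y = 0 := laplacian_zero' y

/-- `∇0 = 0`. [folklore] -/
theorem gradient_zero_scalar (y : 𝕋²) : Torus.gradient (0 : 𝕋² → ℝ) y = 0 := by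
  refine ext_inner_right ℝ fun w => ?_
  rw [Torus.inner_gradient_left, inner_zero_left]
  have h : liftAt (0 : 𝕋² → ℝ) y = fun _ => 0 := by
    funext v; simp [Torus.liftAt_apply]
  simp [Torus.fderiv, h]

/-- **Lifting planar steady states**: if `V` is a smooth steady state of `NS_ν(F)` on `T²`
(`F` smooth, mean zero) then `(V, 0) ∘ π` is a steady state of `NS_ν((F,0) ∘ π)` on `T³` in the
item's sense, against ALL three-dimensional admissible tests (the residual is the lifted
pressure gradient `∇(p ∘ π)`). [folklore] -/
theorem isSteady_twoHalf_planar {ν : ℝ} {F V : 𝕋² → E²} (hF : IsSmooth F) (hF0 : HasZeroMean F)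
    (hV : IsSmooth V) (hVd : IsDivFree V) (hs : IsSteady ν F V) :
    IsSteady ν (twoHalf F 0) (twoHalf V 0) := by
  obtain ⟨p, hp, hpeq⟩ := exists_pressure hF hF0 hV hVd hs
  have hV1 : IsContDiff 1 V := hV.isContDiff (by simp)
  have hZ1 : IsContDiff 1 (0 : 𝕋² → ℝ) := isSmooth_zero_scalar.isContDiff (by simp)
  have hlap := laplacian_twoHalf hV isSmooth_zero_scalar
  have hcon := convect_twoHalf hV1 hZ1
  have hgrad := gradient_comp_planarProj (hp.isContDiff (by simp))
  intro w hw hwd _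
  have hres : ∀ x, ν • laplacian (twoHalf V 0) x - convect (twoHalf V 0) (twoHalf V 0) x +
      twoHalf F 0 x = Torus.gradient (p ∘ planarProj) x := by
    intro x
    rw [hlap, hcon, hgrad]
    simp only [twoHalf, laplacian_zero_scalar, gradient_zero_scalar, inner_zero_right,
      Pi.zero_apply, ← hpeq (planarProj x)]
    rw [← planarEmbed.map_smul, ← planarEmbed.map_sub, ← planarEmbed.map_add]
    congr 1
    ext <;> simp
  simp_rw [hres]
  exact integral_inner_gradient_eq_zero_of_isDivFree hw (hp.comp_planarProj) hwd

/-- **Planar lift of the crux body**: constants certifying FLOOR/CEILING for the lifted force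
`(F, 0) ∘ π` on `T³` certify them for `F` on `T²` (lift every planar steady state; energy and
dissipation are preserved). [folklore] -/
theorem body_of_body_twoHalf {F : 𝕋² → E²} (hF : IsSmooth F) (hF0 : HasZeroMean F)
    (hB : Body (twoHalf F 0)) : Body F := by
  obtain ⟨ε₀, E, ν₀, hε₀, hν₀, h⟩ := hB
  refine ⟨ε₀, E, ν₀, hε₀, hν₀, fun ν hν hνν₀ V hV hVd hV0 hs => ?_⟩
  have hu : IsSmooth (twoHalf V 0) := hV.twoHalf isSmooth_zero_scalar
  have hud : IsDivFree (twoHalf V 0) := hVd.twoHalf 0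
  have hu0 : HasZeroMean (twoHalf V 0) :=
    hasZeroMean_twoHalf hV.integrable (integrable_zero _ _ _) hV0 hasZeroMean_zero'
  have hus := isSteady_twoHalf_planar hF hF0 hV hVd hs
  obtain ⟨hfl, hce⟩ := h ν hν hνν₀ _ hu hud hu0 hus
  have hG : gradNormSq (twoHalf V 0) = gradNormSq V := by
    rw [gradNormSq_twoHalf hV isSmooth_zero_scalar]
    simp [scalarGradNormSq, gradient_zero_scalar]
  have hU : ∫ x, ‖twoHalf V 0 x‖ ^ 2 = ∫ y, ‖V y‖ ^ 2 := by
    rw [integral_norm_sq_twoHalf (R := (0 : 𝕋² → ℝ)) hV.continuous continuous_const]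
    simp
  exact ⟨hG ▸ hfl, hU ▸ hce⟩

/-- **Every planar force is excluded**: for `F : T² → ℝ²` smooth with zero mean, the
`x₃`-invariant horizontal force `(F, 0) ∘ π` is NOT a witness of the crux (its lifted planar
steady states are quiet-or-fat, §5).  The prover's `f` must be genuinely three-dimensional —
the steady-state form of the Alexakis–Doering barrier, proved here for all planar `F`. [folklore] -/
theorem not_body_twoHalf_planar {F : 𝕋² → E²} (hF : IsSmooth F) (hF0 : HasZeroMean F) :
    ¬ Body (twoHalf F 0) :=
  fun hB => not_body_fin_two hF (body_of_body_twoHalf hF hF0 hB)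

/-- Planar lifts of admissible planar forces are admissible three-dimensional forces. [folklore] -/
theorem admissible_twoHalf_planar {F : 𝕋² → E²} (hF : Admissible F) : Admissible (twoHalf F 0) :=
  ⟨hF.1.twoHalf isSmooth_zero_scalar, hF.2.1.twoHalf 0,
    hasZeroMean_twoHalf hF.1.integrable (integrable_zero _ _ _) hF.2.2 hasZeroMean_zero'⟩

/-! ## §7 Unidirectional forces `(0, 0, -ΔS(x₁,x₂))` carry an exact fat laminar branch

For every smooth `S : T² → ℝ` the vertical field `u_ν = (0, 0, S/ν) ∘ π` is an exact steady
state of `NS_ν` with force `(0, 0, -ΔS) ∘ π` (no convection: `(u·∇)u = 0`), of energy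
`‖S‖²/ν² → ∞`.  So the CEILING fails for every such force with `S ≠ 0` — a two-parameter-free
family strictly larger than the Stokes-eigenmode (Kolmogorov) forces of the Marchioro barrier. -/

/-- **The laminar branch**: `(0, 0, ν⁻¹S) ∘ π` is a steady state of `NS_ν((0,0,-ΔS) ∘ π)` for
every `ν ≠ 0` (the residual vanishes identically). [folklore] -/
theorem isSteady_unidirectional {S : 𝕋² → ℝ} (hS : IsSmooth S) {ν : ℝ} (hν : ν ≠ 0) :
    IsSteady ν (twoHalf 0 (fun y => -laplacian S y)) (twoHalf 0 (ν⁻¹ • S)) := by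
  have hSν : IsSmooth (ν⁻¹ • S) := hS.smul _
  have hlap := laplacian_twoHalf isSmooth_zero_planar hSν
  have hcon := convect_twoHalf (isSmooth_zero_planar.isContDiff (by simp)) (hSν.isContDiff (by simp))
  intro w _ _ _
  have hres : ∀ x, ν • laplacian (twoHalf 0 (ν⁻¹ • S)) x -
      convect (twoHalf 0 (ν⁻¹ • S)) (twoHalf 0 (ν⁻¹ • S)) x + twoHalf 0 (fun y => -laplacian S y) x = 0 := by
    intro x
    rw [hlap, hcon]
    simp only [twoHalf, laplacian_zero_planar, laplacian_smul' hS, Pi.zero_apply, inner_zero_left]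
    rw [show convect (0 : 𝕋² → E²) (0 : 𝕋² → E²) (planarProj x) = 0 from convect_zero_left _ _,
      ← planarEmbed.map_smul, ← planarEmbed.map_sub, ← planarEmbed.map_add, ← planarEmbed.map_zero]
    congr 1
    ext <;> simp [← mul_assoc, mul_inv_cancel₀ hν]
  simp_rw [hres]
  simp

/-- Energy of the laminar branch: `‖(0,0,ν⁻¹S) ∘ π‖² = ν⁻² ‖S‖²`. [folklore] -/
theorem energy_unidirectional {S : 𝕋² → ℝ} (hS : IsSmooth S) (ν : ℝ) :
    ∫ x, ‖twoHalf 0 (ν⁻¹ • S) x‖ ^ 2 = (ν⁻¹) ^ 2 * ∫ y, S y ^ 2 := by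
  rw [integral_norm_sq_twoHalf (V := (0 : 𝕋² → E²)) continuous_const (hS.smul _).continuous,
    ← integral_const_mul]
  simp [mul_pow]

/-- A smooth function with a nonzero value has positive square integral. [folklore] -/
theorem integral_sq_pos {S : 𝕋² → ℝ} (hS : IsSmooth S) {y₀ : 𝕋²} (hy₀ : S y₀ ≠ 0) :
    0 < ∫ y, S y ^ 2 := by
  have hc : Continuous fun y => S y ^ 2 := hS.continuous.pow 2
  have hnn : 0 ≤ ∫ y, S y ^ 2 := integral_nonneg fun _ => sq_nonneg _
  rcases hnn.lt_or_eq with h | h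
  · exact h
  · exfalso
    have hae : (fun y => S y ^ 2) =ᵐ[volume] 0 :=
      (integral_eq_zero_iff_of_nonneg (f := fun y => S y ^ 2) (fun y => sq_nonneg _)
        hc.integrable_unitAddTorus).1 h.symm
    have heq : (fun y => S y ^ 2) = 0 := (Continuous.ae_eq_iff_eq volume hc continuous_const).1 hae
    have := congrFun heq y₀
    simp only [Pi.zero_apply, ne_eq, OfNat.ofNat_ne_zero, not_false_eq_true, pow_eq_zero_iff] at this
    exact hy₀ this

/-- **Every nonzero unidirectional force `(0,0,-ΔS) ∘ π` is excluded** (its laminar branch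
`(0,0,S/ν) ∘ π` has energy `‖S‖²/ν² → ∞`, so no CEILING `E` survives `ν → 0`). [folklore] -/
theorem not_body_unidirectional {S : 𝕋² → ℝ} (hS : IsSmooth S) (hS0 : HasZeroMean S) {y₀ : 𝕋²}
    (hy₀ : S y₀ ≠ 0) : ¬ Body (twoHalf 0 (fun y => -laplacian S y)) := by
  rintro ⟨ε₀, E, ν₀, -, hν₀, h⟩
  set P : ℝ := ∫ y, S y ^ 2 with hP
  have hP0 : 0 < P := integral_sq_pos hS hy₀
  set E' : ℝ := max E 1 with hE'
  have hE'1 : 1 ≤ E' := le_max_right _ _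
  have hE'0 : 0 < E' := by positivity
  set ν : ℝ := min (ν₀ / 2) (min 1 (P / (2 * E'))) with hν_def
  have hν : 0 < ν := lt_min (by positivity) (lt_min one_pos (by positivity))
  have hνν₀ : ν < ν₀ := (min_le_left _ _).trans_lt (by linarith)
  have hν1 : ν ≤ 1 := (min_le_right _ _).trans (min_le_left _ _)
  have hνP : ν ≤ P / (2 * E') := (min_le_right _ _).trans (min_le_right _ _)
  have hu : IsSmooth (twoHalf 0 (ν⁻¹ • S)) := isSmooth_zero_planar.twoHalf (hS.smul _)
  have hud : IsDivFree (twoHalf 0 (ν⁻¹ • S)) := IsDivFree.twoHalf isDivFree_zero' _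
  have hu0 : HasZeroMean (twoHalf 0 (ν⁻¹ • S)) :=
    hasZeroMean_twoHalf (integrable_zero _ _ _) (hS.smul _).integrable hasZeroMean_zero'
      (hasZeroMean_smul hS0 _)
  have hce := (h ν hν hνν₀ _ hu hud hu0 (isSteady_unidirectional hS hν.ne')).2
  rw [energy_unidirectional hS ν] at hce
  -- `ν⁻² P ≤ E ≤ E'` contradicts `ν² E' ≤ ν · P/(2E') · E' < P`
  have h1 : (ν⁻¹) ^ 2 * P ≤ E' := hce.trans (le_max_left _ _)
  have h2 : P ≤ ν ^ 2 * E' := by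
    have h3 : ν ^ 2 * ((ν⁻¹) ^ 2 * P) ≤ ν ^ 2 * E' := mul_le_mul_of_nonneg_left h1 (by positivity)
    rwa [← mul_assoc, ← mul_pow, mul_inv_cancel₀ hν.ne', one_pow, one_mul] at h3
  have h4 : ν ^ 2 * E' ≤ P / 2 := by
    have h5 : ν * E' ≤ P / 2 := by
      rw [le_div_iff₀ (by positivity)] at hνP
      linarith
    nlinarith
  linarith

/-! ### A concrete nonzero instance: `S = cos(2π x₁)` -/

/-- `y ↦ cos (2π y₀)` on `ℝ²` is lattice periodic. [folklore] -/
theorem isLatticePeriodic_cos2 :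
    Torus.IsLatticePeriodic (fun y : E² => Real.cos (2 * Real.pi * y 0)) := by
  intro j y
  simp only [PiLp.add_apply, PiLp.single_apply]
  split_ifs with h
  · rw [mul_add, mul_one, Real.cos_add_two_pi]
  · rw [add_zero]

/-- The smooth mean-zero function `cos (2π x₁)` on `T²`. [folklore] -/
def cosX : 𝕋² → ℝ :=
  Torus.descend (fun y : E² => Real.cos (2 * Real.pi * y 0)) isLatticePeriodic_cos2

/-- The lift of `cosX`. [folklore] -/
theorem lift_cosX : Torus.lift cosX = fun y : E² => Real.cos (2 * Real.pi * y 0) :=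
  Torus.lift_descend_holds _ _

/-- `cosX (proj y) = cos (2π y₀)`. [folklore] -/
theorem cosX_proj (y : E²) : cosX (proj y) = Real.cos (2 * Real.pi * y 0) := by
  have h := congrFun lift_cosX y
  rwa [lift_apply] at h

/-- `cosX` is smooth. [folklore] -/
theorem isSmooth_cosX : IsSmooth cosX := by
  unfold IsSmooth
  rw [lift_cosX]
  exact Real.contDiff_cos.comp (contDiff_const.mul (EuclideanSpace.proj (0 : Fin 2) : E² →L[ℝ] ℝ).contDiff)

/-- `cosX 0 = 1`. [folklore] -/
theorem cosX_zero : cosX 0 = 1 := by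
  rw [← proj_zero, cosX_proj]
  simp

/-- Half-period shift: `cosX (x + ½e₀) = -cosX x`. [folklore] -/
theorem cosX_add_half (x : 𝕋²) :
    cosX (x + proj (EuclideanSpace.single (0 : Fin 2) (1 / 2 : ℝ))) = -cosX x := by
  obtain ⟨y, rfl⟩ := proj_surjective x
  rw [← proj_add, cosX_proj, cosX_proj]
  have h : (y + EuclideanSpace.single (0 : Fin 2) (1 / 2 : ℝ)) 0 = y 0 + 1 / 2 := by simp
  rw [h, mul_add, show 2 * Real.pi * (1 / 2 : ℝ) = Real.pi by ring, Real.cos_add_pi]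

/-- `cosX` has zero mean (translation invariance of Haar measure and the half-period shift). [folklore] -/
theorem hasZeroMean_cosX : HasZeroMean cosX := by
  unfold HasZeroMean
  have h := integral_add_right_eq_self (μ := (volume : Measure 𝕋²)) cosX
    (proj (EuclideanSpace.single (0 : Fin 2) (1 / 2 : ℝ)))
  simp_rw [cosX_add_half, integral_neg] at h
  linarith

/-- The concrete unidirectional force `(0, 0, -Δcos(2πx₁)) ∘ π` is excluded. [folklore] -/
theorem not_body_cosX : ¬ Body (twoHalf 0 (fun y => -laplacian cosX y)) :=
  not_body_unidirectional isSmooth_cosX hasZeroMean_cosX (y₀ := 0) (by rw [cosX_zero]; norm_num)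

end Planar

/-! ## §8 Natural strengthenings refuted, and the shape of `¬ crux` -/

/-- **A mean-zero harmonic function on the torus vanishes** (`∫ S ΔS = -‖∇S‖²`, so `∇S = 0`,
then Poincaré–Wirtinger). [folklore] -/
theorem eq_zero_of_laplacian_eq_zero {S : UnitAddTorus d → ℝ} (hS : IsSmooth S) (h0 : HasZeroMean S)
    (hΔ : ∀ x, laplacian S x = 0) : ∀ x, S x = 0 := by
  have hS1 : IsContDiff 1 S := hS.isContDiff (by simp)
  -- `∑ᵢ ∫ (∂ᵢS)² = 0`
  have h1 : ∑ i, ∫ x, partialDeriv i S x * partialDeriv i S x = 0 := by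
    have h := integral_mul_laplacian_eq_neg_sum hS hS
    simp only [hΔ, mul_zero, integral_zero] at h
    linarith
  have hnn : ∀ j, 0 ≤ ∫ x, partialDeriv j S x * partialDeriv j S x :=
    fun j => integral_nonneg fun x => mul_self_nonneg _
  have h2 : ∀ i, ∫ x, partialDeriv i S x * partialDeriv i S x = 0 := fun i =>
    (Finset.sum_eq_zero_iff_of_nonneg fun j _ => hnn j).1 h1 i (Finset.mem_univ i)
  -- `∂ᵢS ≡ 0`
  have h3 : ∀ i x, partialDeriv i S x = 0 := by
    intro i
    have hc : Continuous fun x => partialDeriv i S x * partialDeriv i S x :=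
      (hS.partialDeriv i).continuous.mul (hS.partialDeriv i).continuous
    have hae : (fun x => partialDeriv i S x * partialDeriv i S x) =ᵐ[volume] 0 :=
      (integral_eq_zero_iff_of_nonneg (f := fun x => partialDeriv i S x * partialDeriv i S x)
        (fun x => mul_self_nonneg _) hc.integrable_unitAddTorus).1 (h2 i)
    have heq := (Continuous.ae_eq_iff_eq volume hc continuous_const).1 hae
    intro x
    have hx : (fun x => partialDeriv i S x * partialDeriv i S x) x = (0 : UnitAddTorus d → ℝ) x :=
      congrFun heq x
    exact mul_self_eq_zero.1 hx
  -- `DS ≡ 0`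
  have h4 : ∀ x, Torus.fderiv S x = 0 := by
    intro x
    ext w
    rw [fderiv_apply_eq_sum_partialDeriv hS1]
    simp [h3]
  -- Poincaré–Wirtinger in `L¹`
  have h5 := eLpNorm_le_of_hasZeroMean hS1 h0 (p := 1) le_rfl ENNReal.one_ne_top
  have h6 : eLpNorm (fun x => ‖Torus.fderiv S x‖) 1 volume = 0 := by
    simp [h4]
  rw [h6, mul_zero, nonpos_iff_eq_zero] at h5
  have h7 : S =ᵐ[volume] 0 :=
    (eLpNorm_eq_zero_iff hS.continuous.aestronglyMeasurable one_ne_zero).1 h5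
  have h8 := (Continuous.ae_eq_iff_eq volume hS.continuous continuous_const).1 h7
  exact fun x => congrFun h8 x

section Strengthenings

open Literature.Analysis.FunctionSpaces.Torus (twoHalf planarProj planarEmbed)

/-- Local notation: the flat two-torus. -/
local notation "𝕋²" => UnitAddTorus (Fin 2)
/-- Local notation: `ℝ²`. -/
local notation "E²" => EuclideanSpace ℝ (Fin 2)

/-- `Δ cos(2πx₁)` does not vanish identically. [folklore] -/
theorem exists_laplacian_cosX_ne_zero : ∃ y : 𝕋², laplacian cosX y ≠ 0 := by
  by_contra h
  push Not at h
  have h0 := eq_zero_of_laplacian_eq_zero isSmooth_cosX hasZeroMean_cosX h 0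
  rw [cosX_zero] at h0
  exact one_ne_zero h0

/-- The concrete unidirectional force is admissible (smooth, divergence free, mean zero). [folklore] -/
theorem admissible_cosX_force : Admissible (twoHalf 0 (fun y => -laplacian cosX y)) := by
  refine ⟨isSmooth_zero_planar.twoHalf isSmooth_cosX.laplacian.neg,
    IsDivFree.twoHalf isDivFree_zero' _, ?_⟩
  refine hasZeroMean_twoHalf (integrable_zero _ _ _) isSmooth_cosX.laplacian.neg.integrable
    hasZeroMean_zero' ?_
  unfold HasZeroMean
  rw [integral_neg, show (∫ y, laplacian cosX y) = 0 from hasZeroMean_laplacian isSmooth_cosX,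
    neg_zero]

/-- The concrete unidirectional force is not the zero field. [folklore] -/
theorem cosX_force_ne_zero :
    (twoHalf 0 (fun y => -laplacian cosX y) : UnitAddTorus (Fin 3) → EuclideanSpace ℝ (Fin 3)) ≠
      fun _ => 0 := by
  obtain ⟨y₀, hy₀⟩ := exists_laplacian_cosX_ne_zero
  intro h
  have hx := congrFun h (Fin.snoc y₀ 0)
  have h2 : twoHalf 0 (fun y => -laplacian cosX y) (Fin.snoc y₀ 0 : UnitAddTorus (Fin 3)) 2 = 0 := by
    rw [hx]; simp
  rw [Literature.Analysis.FunctionSpaces.Torus.twoHalf_apply_two] at h2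
  have hp : planarProj (Fin.snoc y₀ 0 : UnitAddTorus (Fin 3)) = y₀ := by
    funext j
    simp [planarProj]
  rw [hp, neg_eq_zero] at h2
  exact hy₀ h2

/-- **Strengthening `∃ f` to `∀ f ≠ 0` is false**: not every nonzero admissible force works —
the unidirectional force `(0,0,-Δcos 2πx₁)` carries the fat laminar branch of §7.  (The choice
of `f` is the whole content of the crux; together with §6 every `x₃`-invariant force that is
purely horizontal or purely vertical is excluded.) [folklore] -/
theorem not_forall_admissible_body :
    ¬ ∀ f : UnitAddTorus (Fin 3) → EuclideanSpace ℝ (Fin 3), Admissible f → f ≠ (fun _ => 0) →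
        Body f :=
  fun h => not_body_cosX (h _ admissible_cosX_force cosX_force_ne_zero)

end Strengthenings

/-- **The shape of a refutation of the crux body** ("quiet-or-fat branch"): `¬ Body f` says that
for all candidate constants there is a viscosity in range and a smooth steady state which, if it
is loud (`ν‖∇u‖² ≥ ε₀`), is fat (`‖u‖² > E`). [folklore] -/
theorem not_body_iff (f : UnitAddTorus d → EuclideanSpace ℝ d) :
    ¬ Body f ↔ ∀ ε₀ E ν₀ : ℝ, 0 < ε₀ → 0 < ν₀ → ∃ ν : ℝ, 0 < ν ∧ ν < ν₀ ∧
      ∃ u : UnitAddTorus d → EuclideanSpace ℝ d, IsSmooth u ∧ IsDivFree u ∧ HasZeroMean u ∧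
        IsSteady ν f u ∧ (ε₀ ≤ ν * gradNormSq u → E < ∫ x, ‖u x‖ ^ 2) := by
  unfold Body LoudBounded
  push Not
  rfl

/-- **What a refutation of the crux must deliver**: a quiet-or-fat steady branch for EVERY
admissible three-dimensional force. [folklore] -/
theorem not_crux_iff :
    ¬ SteadyStatesLoudBounded ↔
      ∀ f : UnitAddTorus (Fin 3) → EuclideanSpace ℝ (Fin 3), IsSmooth f → IsDivFree f →
        HasZeroMean f → ¬ Body f := by
  rw [crux_iff]
  simp only [not_exists, not_and]

/-! ## §9 Fat laminar branches from steady Euler flows; the energy shell of loud states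

The mechanism behind §7 and behind the Marchioro / Kolmogorov / Beltrami (ABC) examples in one
statement: if `U` is ANY smooth steady Euler flow (`(U·∇)U = ∇q`) then for the force `f = -ΔU`
the rescaled flow `U/ν` is an exact steady state of `NS_ν(f)` — viscosity balances the force,
the nonlinearity is a pressure — with energy `‖U‖²/ν² → ∞`.  So `-Δ(steady Euler flow)` is never
a witness.  (Shear flows: `q = 0`; Beltrami `curl U = λU`: `q = |U|²/2`; unidirectional
`U = (0,0,S)∘π`: `q = 0`, which is §7.) -/

omit [DecidableEq d] in
/-- `∫⟪c • g, w⟫ = c ∫⟪g, w⟫`. [folklore] -/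
theorem integral_inner_smul_left' {F : Type*} [NormedAddCommGroup F] [InnerProductSpace ℝ F]
    (c : ℝ) (g w : UnitAddTorus d → F) :
    ∫ x, ⟪c • g x, w x⟫_ℝ = c * ∫ x, ⟪g x, w x⟫_ℝ := by
  simp_rw [real_inner_smul_left, integral_const_mul]

/-- **The laminar branch of a steady Euler flow**: if `(U·∇)U = ∇q` then `ν⁻¹U` is a steady
state of `NS_ν(-ΔU)` for every `ν ≠ 0` (residual `= -ν⁻²∇q`). [folklore] -/
theorem isSteady_laminar_of_euler {U : UnitAddTorus d → EuclideanSpace ℝ d} {q : UnitAddTorus d → ℝ}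
    (hU : IsSmooth U) (hq : IsSmooth q) (heuler : ∀ x, convect U U x = Torus.gradient q x) {ν : ℝ}
    (hν : ν ≠ 0) : IsSteady ν (fun x => -laplacian U x) (ν⁻¹ • U) := by
  intro w hw hwd _
  have hres : ∀ x, ν • laplacian (ν⁻¹ • U) x - convect (ν⁻¹ • U) (ν⁻¹ • U) x + -laplacian U x =
      (-(ν⁻¹ * ν⁻¹)) • Torus.gradient q x := by
    intro x
    rw [laplacian_smul' hU, convect_smul_smul (hU.isContDiff (by simp)), heuler, smul_smul,
      mul_inv_cancel₀ hν, one_smul, neg_smul]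
    abel
  simp_rw [hres, integral_inner_smul_left']
  rw [integral_inner_gradient_eq_zero_of_isDivFree hw hq hwd, mul_zero]

omit [DecidableEq d] in
/-- A smooth field with a nonzero value has positive energy. [folklore] -/
theorem integral_norm_sq_pos {F : Type*} [NormedAddCommGroup F] [InnerProductSpace ℝ F]
    {U : UnitAddTorus d → F} (hU : IsSmooth U) {x₀ : UnitAddTorus d} (hx₀ : U x₀ ≠ 0) :
    0 < ∫ x, ‖U x‖ ^ 2 := by
  have hc : Continuous fun x => ‖U x‖ ^ 2 := hU.continuous.norm.pow 2
  have hnn : 0 ≤ ∫ x, ‖U x‖ ^ 2 := integral_nonneg fun _ => sq_nonneg _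
  rcases hnn.lt_or_eq with h | h
  · exact h
  · exfalso
    have hae : (fun x => ‖U x‖ ^ 2) =ᵐ[volume] 0 :=
      (integral_eq_zero_iff_of_nonneg (f := fun x => ‖U x‖ ^ 2) (fun x => sq_nonneg _)
        hc.integrable_unitAddTorus).1 h.symm
    have heq : (fun x => ‖U x‖ ^ 2) = 0 := (Continuous.ae_eq_iff_eq volume hc continuous_const).1 hae
    have h1 : (fun x => ‖U x‖ ^ 2) x₀ = (0 : UnitAddTorus d → ℝ) x₀ := congrFun heq x₀
    have h2 : ‖U x₀‖ ^ 2 = 0 := h1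
    exact hx₀ (by simpa using h2)

/-- **`-Δ(steady Euler flow)` is never a witness.**  For every smooth divergence-free mean-zero
`U ≢ 0` with `(U·∇)U = ∇q` (a smooth steady Euler flow), the force `f = -ΔU` carries the exact
fat branch `U/ν` (`isSteady_laminar_of_euler`) of energy `‖U‖²/ν²`, so the CEILING fails as
`ν → 0`: `¬ Body (-ΔU)`.  Covers Kolmogorov/shear forces, Beltrami/ABC forces, and §7. [folklore] -/
theorem not_body_neg_laplacian_of_euler {U : UnitAddTorus d → EuclideanSpace ℝ d}
    {q : UnitAddTorus d → ℝ} (hU : IsSmooth U) (hUd : IsDivFree U) (hU0 : HasZeroMean U)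
    (hq : IsSmooth q) (heuler : ∀ x, convect U U x = Torus.gradient q x) {x₀ : UnitAddTorus d}
    (hx₀ : U x₀ ≠ 0) : ¬ Body (fun x => -laplacian U x) := by
  rintro ⟨ε₀, E, ν₀, -, hν₀, h⟩
  set P : ℝ := ∫ x, ‖U x‖ ^ 2 with hP
  have hP0 : 0 < P := integral_norm_sq_pos hU hx₀
  set E' : ℝ := max E 1 with hE'
  have hE'0 : 0 < E' := lt_of_lt_of_le one_pos (le_max_right _ _)
  set ν : ℝ := min (ν₀ / 2) (min 1 (P / (2 * E'))) with hν_def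
  have hν : 0 < ν := lt_min (by positivity) (lt_min one_pos (by positivity))
  have hνν₀ : ν < ν₀ := (min_le_left _ _).trans_lt (by linarith)
  have hν1 : ν ≤ 1 := (min_le_right _ _).trans (min_le_left _ _)
  have hνP : ν ≤ P / (2 * E') := (min_le_right _ _).trans (min_le_right _ _)
  have hu : IsSmooth (ν⁻¹ • U) := hU.smul _
  have hud : IsDivFree (ν⁻¹ • U) := isDivFree_smul hUd _
  have hu0 : HasZeroMean (ν⁻¹ • U) := hasZeroMean_smul hU0 _
  have hce := (h ν hν hνν₀ _ hu hud hu0 (isSteady_laminar_of_euler hU hq heuler hν.ne')).2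
  have hEn : ∫ x, ‖(ν⁻¹ • U) x‖ ^ 2 = (ν⁻¹) ^ 2 * P := by
    rw [hP, ← integral_const_mul]
    refine integral_congr_ae (ae_of_all _ fun x => ?_)
    simp [norm_smul, mul_pow]
  rw [hEn] at hce
  have h1 : (ν⁻¹) ^ 2 * P ≤ E' := hce.trans (le_max_left _ _)
  have h2 : P ≤ ν ^ 2 * E' := by
    have h3 : ν ^ 2 * ((ν⁻¹) ^ 2 * P) ≤ ν ^ 2 * E' := mul_le_mul_of_nonneg_left h1 (by positivity)
    rwa [← mul_assoc, ← mul_pow, mul_inv_cancel₀ hν.ne', one_pow, one_mul] at h3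
  have h4 : ν ^ 2 * E' ≤ P / 2 := by
    have h5 : ν * E' ≤ P / 2 := by
      rw [le_div_iff₀ (by positivity)] at hνP
      linarith
    nlinarith
  linarith

/-- **The energy shell of loud states**: at a steady state, the FLOOR `ε₀ ≤ ν‖∇u‖² = (f,u)`
forces `‖u‖² ≥ ε₀²/‖f‖²` (Cauchy–Schwarz, here via Young with the optimal weight).  Hence
`Body f` confines ALL small-viscosity steady states of `f` to the shell
`ε₀²/‖f‖² ≤ ‖u‖² ≤ E`. [folklore] -/
theorem energy_floor_of_floor {ν ε₀ : ℝ} {f u : UnitAddTorus d → EuclideanSpace ℝ d}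
    (hf : IsSmooth f) (hu : IsSmooth u) (hdiv : IsDivFree u) (h0 : HasZeroMean u)
    (hs : IsSteady ν f u) (hε₀ : 0 < ε₀) (hF : 0 < ∫ x, ‖f x‖ ^ 2)
    (hfloor : ε₀ ≤ ν * gradNormSq u) :
    ε₀ ^ 2 / (∫ x, ‖f x‖ ^ 2) ≤ ∫ x, ‖u x‖ ^ 2 := by
  set F : ℝ := ∫ x, ‖f x‖ ^ 2 with hFdef
  have hE := energy_identity hf hu hdiv h0 hs
  -- Young with weights `ε₀/(2F)`, `F/(2ε₀)`
  have hαβ : (1 : ℝ) ≤ 4 * (ε₀ / (2 * F)) * (F / (2 * ε₀)) := by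
    rw [show 4 * (ε₀ / (2 * F)) * (F / (2 * ε₀)) = (4 * ε₀ * F) / (4 * ε₀ * F) by ring,
      div_self (by positivity)]
  have hY := integral_inner_le_young hf hu (by positivity : 0 < ε₀ / (2 * F)) hαβ
  rw [← hE] at hY
  have h1 : ε₀ ≤ ε₀ / (2 * F) * F + F / (2 * ε₀) * ∫ x, ‖u x‖ ^ 2 := hfloor.trans hY
  have h2 : ε₀ / (2 * F) * F = ε₀ / 2 := by
    rw [div_mul_eq_mul_div, mul_div_mul_right ε₀ 2 hF.ne']
  rw [h2] at h1
  rw [div_le_iff₀ hF]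
  have h3 : ε₀ / 2 ≤ F / (2 * ε₀) * ∫ x, ‖u x‖ ^ 2 := by linarith
  have h4 := mul_le_mul_of_nonneg_left h3 (by positivity : (0 : ℝ) ≤ 2 * ε₀)
  have h5 : 2 * ε₀ * (F / (2 * ε₀) * ∫ x, ‖u x‖ ^ 2) = (∫ x, ‖u x‖ ^ 2) * F := by
    rw [show 2 * ε₀ * (F / (2 * ε₀) * ∫ x, ‖u x‖ ^ 2) = (2 * ε₀) / (2 * ε₀) * ((∫ x, ‖u x‖ ^ 2) * F)
      by ring, div_self (by positivity), one_mul]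
  nlinarith

/-! ## §10 Scaling covariance: only the SHAPE of `f` matters

`NS_ν(a²f)` and `NS_{ν/a}(f)` have the same steady states up to `u ↦ a u` (`a > 0`), with
dissipation scaling by `a³` and energy by `a²`.  Hence `Body f ↔ Body (a² • f)`: the witness set
of the crux is a cone, the amplitude of `f` is free, and the crux is a statement about the shape
of the force only (equivalently about the large-Grashof limit at fixed shape). -/

omit [DecidableEq d] in
/-- Residual scaling: `ν Δ(a u) − ((a u)·∇)(a u) + a² f = a² (ν/a Δu − (u·∇)u + f)`. [folklore] -/
theorem residual_smul {ν a : ℝ} (ha : a ≠ 0) {f u : UnitAddTorus d → EuclideanSpace ℝ d}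
    (hu : IsSmooth u) (x : UnitAddTorus d) :
    ν • laplacian (a • u) x - convect (a • u) (a • u) x + (a ^ 2 • f) x =
      (a ^ 2) • ((ν / a) • laplacian u x - convect u u x + f x) := by
  have h1 : a ^ 2 * (ν / a) = ν * a := by
    rw [sq, mul_assoc, mul_div_assoc', mul_div_cancel_left₀ ν ha, mul_comm]
  rw [laplacian_smul' hu, convect_smul_smul (hu.isContDiff (by simp)), Pi.smul_apply, smul_add,
    smul_sub, smul_smul, smul_smul, h1, sq]

/-- **Steady states scale**: `a u` is a steady state of `NS_ν(a² f)` iff `u` is a steady state of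
`NS_{ν/a}(f)` (`a ≠ 0`). [folklore] -/
theorem isSteady_smul_iff {ν a : ℝ} (ha : a ≠ 0) {f u : UnitAddTorus d → EuclideanSpace ℝ d}
    (hu : IsSmooth u) : IsSteady ν (a ^ 2 • f) (a • u) ↔ IsSteady (ν / a) f u := by
  have key : ∀ w : UnitAddTorus d → EuclideanSpace ℝ d,
      ∫ x, ⟪ν • laplacian (a • u) x - convect (a • u) (a • u) x + (a ^ 2 • f) x, w x⟫_ℝ =
        a ^ 2 * ∫ x, ⟪(ν / a) • laplacian u x - convect u u x + f x, w x⟫_ℝ := by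
    intro w
    simp_rw [residual_smul ha hu, integral_inner_smul_left']
  have ha2 : a ^ 2 ≠ 0 := pow_ne_zero 2 ha
  constructor
  · intro h w hw hwd hw0
    have h1 := h w hw hwd hw0
    rw [key] at h1
    rcases mul_eq_zero.1 h1 with h2 | h2
    · exact absurd h2 ha2
    · exact h2
  · intro h w hw hwd hw0
    rw [key, h w hw hwd hw0, mul_zero]

/-- **The witness set is a cone**: `Body f → Body (a² • f)` for `a > 0`, with constants
`(a³ε₀, a²E, aν₀)`. [folklore] -/
theorem body_smul {f : UnitAddTorus d → EuclideanSpace ℝ d} {a : ℝ} (ha : 0 < a) (hB : Body f) :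
    Body (a ^ 2 • f) := by
  obtain ⟨ε₀, E, ν₀, hε₀, hν₀, h⟩ := hB
  refine ⟨a ^ 3 * ε₀, a ^ 2 * E, a * ν₀, by positivity, by positivity, ?_⟩
  intro ν hν hνν₀ v hv hvd hv0 hs
  -- `v = a • u` with `u = a⁻¹ • v`, a steady state of `NS_{ν/a}(f)`
  have hva : v = a • (a⁻¹ • v) := by rw [smul_smul, mul_inv_cancel₀ ha.ne', one_smul]
  have hu : IsSmooth (a⁻¹ • v) := hv.smul _
  have hs' : IsSteady (ν / a) f (a⁻¹ • v) := by
    rw [hva] at hs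
    exact (isSteady_smul_iff ha.ne' hu).1 hs
  have hνa : 0 < ν / a := div_pos hν ha
  have hνa' : ν / a < ν₀ := by rw [div_lt_iff₀ ha]; linarith
  obtain ⟨hfl, hce⟩ := h (ν / a) hνa hνa' (a⁻¹ • v) hu (isDivFree_smul hvd _)
    (hasZeroMean_smul hv0 _) hs'
  rw [gradNormSq_smul'] at hfl
  have hEv : ∫ x, ‖(a⁻¹ • v) x‖ ^ 2 = (a⁻¹) ^ 2 * ∫ x, ‖v x‖ ^ 2 := by
    rw [← integral_const_mul]
    refine integral_congr_ae (ae_of_all _ fun x => ?_)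
    simp [norm_smul, mul_pow]
  rw [hEv] at hce
  constructor
  · -- `ε₀ ≤ (ν/a) a⁻² G(v)` gives `a³ ε₀ ≤ ν G(v)`
    have h1 : ν / a * ((a⁻¹) ^ 2 * gradNormSq v) = (a ^ 3)⁻¹ * (ν * gradNormSq v) := by
      field_simp
    rw [h1] at hfl
    have h2 := mul_le_mul_of_nonneg_left hfl (by positivity : (0 : ℝ) ≤ a ^ 3)
    rwa [← mul_assoc, mul_inv_cancel₀ (by positivity), one_mul] at h2
  · have h2 := mul_le_mul_of_nonneg_left hce (by positivity : (0 : ℝ) ≤ a ^ 2)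
    rwa [← mul_assoc, ← mul_pow, mul_inv_cancel₀ ha.ne', one_pow, one_mul] at h2

/-- **Scaling covariance of the crux body**: `Body f ↔ Body (a² • f)` for every `a > 0`. [folklore] -/
theorem body_smul_iff {f : UnitAddTorus d → EuclideanSpace ℝ d} {a : ℝ} (ha : 0 < a) :
    Body (a ^ 2 • f) ↔ Body f := by
  refine ⟨fun h => ?_, body_smul ha⟩
  have h' := body_smul (inv_pos.2 ha) h
  rwa [smul_smul, ← mul_pow, inv_mul_cancel₀ ha.ne', one_pow, one_smul] at h'

/-! ## §11 No junk in the formulation: pressure form, the test class, weak solutions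

Three equivalent readings of the crux's hypothesis on `u` (for admissible `f`): the item's weak
form against smooth divergence-free MEAN-ZERO tests; the same against ALL smooth
divergence-free tests; the classical equation `νΔu − (u·∇)u + f = ∇p` with a smooth pressure.
And the restriction to SMOOTH steady states loses nothing: `Body f` is equivalent to its
`H¹`-weak version over Temam's steady weak solutions `U ∈ V` (regularity), with the spectral
enstrophy `eGradNormSq` and the `H`-norm — so neither the test class nor `IsSmooth u` is
load-bearing. -/

/-- **Pressure form**: for admissible data the item's steady weak form is the classical steady
equation with a smooth pressure. [folklore] -/
theorem isSteady_iff_exists_pressure {ν : ℝ} {f u : UnitAddTorus d → EuclideanSpace ℝ d}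
    (hf : IsSmooth f) (hf0 : HasZeroMean f) (hu : IsSmooth u) (hdiv : IsDivFree u) :
    IsSteady ν f u ↔ ∃ p : UnitAddTorus d → ℝ, IsSmooth p ∧
      ∀ x, ν • laplacian u x - convect u u x + f x = Torus.gradient p x := by
  refine ⟨exists_pressure hf hf0 hu hdiv, ?_⟩
  rintro ⟨p, hp, hpeq⟩ w hw hwd _
  simp_rw [hpeq]
  exact integral_inner_gradient_eq_zero_of_isDivFree hw hp hwd

/-- **The mean-zero restriction on tests is harmless**: the weak form holds against every smooth
divergence-free test, mean zero or not. [folklore] -/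
theorem isSteady_iff_forall_divFree_tests {ν : ℝ} {f u : UnitAddTorus d → EuclideanSpace ℝ d}
    (hf : IsSmooth f) (hf0 : HasZeroMean f) (hu : IsSmooth u) (hdiv : IsDivFree u) :
    IsSteady ν f u ↔ ∀ w : UnitAddTorus d → EuclideanSpace ℝ d, IsSmooth w → IsDivFree w →
      ∫ x, ⟪ν • laplacian u x - convect u u x + f x, w x⟫_ℝ = 0 := by
  constructor
  · intro h w hw hwd
    obtain ⟨p, hp, hpeq⟩ := exists_pressure hf hf0 hu hdiv h
    simp_rw [hpeq]
    exact integral_inner_gradient_eq_zero_of_isDivFree hw hp hwd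
  · intro h w hw hwd _
    exact h w hw hwd

/-- The crux body over Temam's steady WEAK solutions `U ∈ V` (spectral enstrophy, `H`-norm). [folklore] -/
def BodyWeak (f : UnitAddTorus d → EuclideanSpace ℝ d) : Prop :=
  ∃ ε₀ E ν₀ : ℝ, 0 < ε₀ ∧ 0 < ν₀ ∧ ∀ ν : ℝ, 0 < ν → ν < ν₀ → ∀ U : energySpace d,
    (U : L2T d) ∈ energySpaceV d → IsSteadyWeakSolution ν f U →
      ε₀ ≤ ν * (eGradNormSq ((U : L2T d) : UnitAddTorus d → EuclideanSpace ℝ d)).toReal ∧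
        ‖U‖ ^ 2 ≤ E

/-- `‖toH u‖² = ∫‖u‖²`. [folklore] -/
theorem norm_sq_toH {u : UnitAddTorus d → EuclideanSpace ℝ d} (hu : IsSmooth u) (hdiv : IsDivFree u)
    (h0 : HasZeroMean u) : ‖toH u hu hdiv h0‖ ^ 2 = ∫ x, ‖u x‖ ^ 2 := by
  rw [show ‖toH u hu hdiv h0‖ = ‖(toH u hu hdiv h0 : L2T d)‖ from rfl, ← real_inner_self_eq_norm_sq,
    MeasureTheory.L2.inner_def]
  refine integral_congr_ae ?_
  filter_upwards [coe_toH_ae_eq hu hdiv h0] with x hx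
  rw [hx, real_inner_self_eq_norm_sq]

/-- A smooth representative of an element of `H` is divergence free and mean zero. [folklore] -/
theorem admissible_of_repr {U : energySpace d} {v : UnitAddTorus d → EuclideanSpace ℝ d}
    (hv : IsSmooth v) (hUv : ((U : L2T d) : UnitAddTorus d → EuclideanSpace ℝ d) =ᵐ[volume] v) :
    IsDivFree v ∧ HasZeroMean v := by
  have hmem := (mem_energySpace_iff_holds (d := d) (U : L2T d)).1 U.2
  have hvw : IsWeaklyDivFree v := by
    intro θ hθ
    have h := hmem.1 θ hθ
    rw [← h]
    refine integral_congr_ae ?_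
    filter_upwards [hUv] with x hx
    rw [hx]
  have hv0 : HasZeroMean v := by
    have h := hmem.2
    unfold HasZeroMean at h ⊢
    rw [← h]
    exact integral_congr_ae hUv.symm
  exact ⟨isDivFree_of_isWeaklyDivFree hv hvw, hv0⟩

/-- The lift of a smooth representative is the original class. [folklore] -/
theorem toH_eq_of_repr {U : energySpace d} {v : UnitAddTorus d → EuclideanSpace ℝ d}
    (hv : IsSmooth v) (hdiv : IsDivFree v) (h0 : HasZeroMean v)
    (hUv : ((U : L2T d) : UnitAddTorus d → EuclideanSpace ℝ d) =ᵐ[volume] v) :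
    toH v hv hdiv h0 = U :=
  Subtype.ext (Lp.ext ((coe_toH_ae_eq hv hdiv h0).trans hUv.symm))

/-- **`IsSmooth u` is not load-bearing**: for smooth `f` in `#d ≤ 3` the crux body over smooth
steady states equals the body over all steady weak solutions `U ∈ V` (Temam regularity for one
direction, `𝒱 ⊆ V` for the other; enstrophy and energy agree along the a.e. identification). [folklore] -/
theorem body_iff_bodyWeak (hd : Fintype.card d ≤ 3) {f : UnitAddTorus d → EuclideanSpace ℝ d}
    (hf : IsSmooth f) : Body f ↔ BodyWeak f := by
  constructor
  · rintro ⟨ε₀, E, ν₀, hε₀, hν₀, h⟩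
    refine ⟨ε₀, E, ν₀, hε₀, hν₀, fun ν hν hνν₀ U hUV hU => ?_⟩
    obtain ⟨v, hv, hUv⟩ := Torus.Temam1979_steadyWeakSolution_smooth_holds hd hν hf hUV hU
    obtain ⟨hvdiv, hv0⟩ := admissible_of_repr hv hUv
    have hUeq := toH_eq_of_repr hv hvdiv hv0 hUv
    have hs : IsSteady ν f v := by
      rw [isSteady_iff_isSteadyWeakSolution hf hv hvdiv hv0, hUeq]; exact hU
    obtain ⟨hfl, hce⟩ := h ν hν hνν₀ v hv hvdiv hv0 hs
    constructor
    · rw [eGradNormSq_congr_ae_field hUv, eGradNormSq_eq_ofReal_gradNormSq hv,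
        ENNReal.toReal_ofReal (gradNormSq_nonneg v)]
      exact hfl
    · rw [← hUeq, norm_sq_toH]
      exact hce
  · rintro ⟨ε₀, E, ν₀, hε₀, hν₀, h⟩
    refine ⟨ε₀, E, ν₀, hε₀, hν₀, fun ν hν hνν₀ u hu hdiv h0 hs => ?_⟩
    have hUV : (toH u hu hdiv h0 : L2T d) ∈ energySpaceV d :=
      smoothSolenoidal_subset_energySpaceV_holds ⟨u, hu, hdiv, h0, coe_toH_ae_eq hu hdiv h0⟩
    have hU : IsSteadyWeakSolution ν f (toH u hu hdiv h0) :=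
      (isSteady_iff_isSteadyWeakSolution hf hu hdiv h0).1 hs
    obtain ⟨hfl, hce⟩ := h ν hν hνν₀ _ hUV hU
    constructor
    · rw [eGradNormSq_congr_ae_field (coe_toH_ae_eq hu hdiv h0), eGradNormSq_eq_ofReal_gradNormSq hu,
        ENNReal.toReal_ofReal (gradNormSq_nonneg u)] at hfl
      exact hfl
    · rw [norm_sq_toH] at hce
      exact hce

/-! ## §12 Steady states of a nonzero force are never small (uniformly in `ν`)

Testing the steady equation with the force itself (`w = f` is admissible) gives
`‖f‖² = -ν(u, Δf) - ∫⟪(u·∇)f, u⟫ ≤ (sup‖∇f‖ + ν/2)‖u‖² + (ν/2)‖Δf‖²`: every steady state of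
`NS_ν(f)` has energy `≳ ‖f‖²/(2 sup‖∇f‖)` once `ν ≲ ‖f‖²/‖Δf‖²`, with NO floor assumed.  So a
quiet branch (if any) is never a small branch: "quiet" can only mean an `O(1)`-energy state on
which the work `(f,u)` degenerates — an inviscid (forced-Euler-type) object — and the CEILING `E`
of any witness must exceed `‖f‖²/(2 sup‖∇f‖)`. -/

omit [DecidableEq d] in
/-- The torus derivative of a smooth map is bounded (continuity on the compact torus). [folklore] -/
theorem exists_bound_fderiv {F : Type*} [NormedAddCommGroup F] [NormedSpace ℝ F]
    {f : UnitAddTorus d → F} (hf : IsSmooth f) : ∃ M : ℝ, 0 ≤ M ∧ ∀ x, ‖Torus.fderiv f x‖ ≤ M := by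
  have hf1 : IsContDiff 1 f := hf.isContDiff (by simp)
  have hc : Continuous (Torus.fderiv f) := hf1.continuous_fderiv
  obtain ⟨C, hC⟩ := isCompact_univ.exists_bound_of_continuousOn hc.continuousOn
  exact ⟨max C 0, le_max_right _ _, fun x => (hC x (Set.mem_univ x)).trans (le_max_left _ _)⟩

/-- **Energy of every steady state is bounded below**: for admissible `f`, a smooth admissible
steady state `u` of `NS_ν(f)` (`ν ≥ 0`) and a bound `‖Df‖ ≤ M`,
`‖f‖² ≤ (M + ν/2)‖u‖² + (ν/2)‖Δf‖²` (test with `w = f`; antisymmetry; Young). [folklore] -/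
theorem norm_sq_force_le {ν : ℝ} (hν : 0 ≤ ν) {f u : UnitAddTorus d → EuclideanSpace ℝ d}
    (hf : IsSmooth f) (hfd : IsDivFree f) (hf0 : HasZeroMean f) (hu : IsSmooth u)
    (hdiv : IsDivFree u) (hs : IsSteady ν f u) {M : ℝ} (hM : ∀ x, ‖Torus.fderiv f x‖ ≤ M) :
    ∫ x, ‖f x‖ ^ 2 ≤ (M + ν / 2) * (∫ x, ‖u x‖ ^ 2) + ν / 2 * ∫ x, ‖laplacian f x‖ ^ 2 := by
  have h := hs f hf hfd hf0
  rw [residual_pairing_eq hf hu hdiv hf] at h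
  have hff : ∫ x, ⟪f x, f x⟫_ℝ = ∫ x, ‖f x‖ ^ 2 :=
    integral_congr_ae (ae_of_all _ fun x => real_inner_self_eq_norm_sq _)
  rw [hff] at h
  -- the viscous term: `-ν(u,Δf) ≤ ν(‖u‖²/2 + ‖Δf‖²/2)`
  have hY := integral_inner_le_young hu.neg hf.laplacian (by norm_num : (0 : ℝ) < 1 / 2)
    (by norm_num : (1 : ℝ) ≤ 4 * (1 / 2) * (1 / 2))
  have e1 : ∫ x, ⟪(-u) x, laplacian f x⟫_ℝ = -∫ x, ⟪u x, laplacian f x⟫_ℝ := by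
    rw [← integral_neg]
    exact integral_congr_ae (ae_of_all _ fun x => by simp [inner_neg_left])
  have e2 : ∫ x, ‖(-u) x‖ ^ 2 = ∫ x, ‖u x‖ ^ 2 :=
    integral_congr_ae (ae_of_all _ fun x => by simp [norm_neg])
  rw [e1, e2] at hY
  have h1 : -(ν * ∫ x, ⟪u x, laplacian f x⟫_ℝ) ≤
      ν * (1 / 2 * (∫ x, ‖u x‖ ^ 2) + 1 / 2 * ∫ x, ‖laplacian f x‖ ^ 2) := by
    have := mul_le_mul_of_nonneg_left hY hν
    linarith
  -- the convective term: `-∫⟪(u·∇)f, u⟫ ≤ M ∫‖u‖²`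
  have h2 : -(∫ x, ⟪convect u f x, u x⟫_ℝ) ≤ M * ∫ x, ‖u x‖ ^ 2 := by
    rw [← integral_neg, ← integral_const_mul]
    refine integral_mono ((hu.convect hf).inner hu).integrable.neg (hu.norm_sq.integrable.const_mul M)
      fun x => ?_
    have hle : |⟪convect u f x, u x⟫_ℝ| ≤ ‖convect u f x‖ * ‖u x‖ := abs_real_inner_le_norm _ _
    have hcv : ‖convect u f x‖ ≤ M * ‖u x‖ :=
      ((Torus.fderiv f x).le_opNorm (u x)).trans (mul_le_mul_of_nonneg_right (hM x) (norm_nonneg _))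
    have hneg : -⟪convect u f x, u x⟫_ℝ ≤ |⟪convect u f x, u x⟫_ℝ| := neg_le_abs _
    calc -⟪convect u f x, u x⟫_ℝ ≤ ‖convect u f x‖ * ‖u x‖ := hneg.trans hle
      _ ≤ M * ‖u x‖ * ‖u x‖ := mul_le_mul_of_nonneg_right hcv (norm_nonneg _)
      _ = M * ‖u x‖ ^ 2 := by ring
  nlinarith

/-- **Corollary (ν-uniform energy floor for ALL steady states)**: if `ν ‖Δf‖² ≤ ‖f‖²` then
`‖f‖² ≤ (2M + ν) ‖u‖²` for every smooth admissible steady state `u` of `NS_ν(f)`. [folklore] -/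
theorem energy_lower_all_steady {ν : ℝ} (hν : 0 ≤ ν) {f u : UnitAddTorus d → EuclideanSpace ℝ d}
    (hf : IsSmooth f) (hfd : IsDivFree f) (hf0 : HasZeroMean f) (hu : IsSmooth u)
    (hdiv : IsDivFree u) (hs : IsSteady ν f u) {M : ℝ} (hM : ∀ x, ‖Torus.fderiv f x‖ ≤ M)
    (hsmall : ν * (∫ x, ‖laplacian f x‖ ^ 2) ≤ ∫ x, ‖f x‖ ^ 2) :
    ∫ x, ‖f x‖ ^ 2 ≤ (2 * M + ν) * ∫ x, ‖u x‖ ^ 2 := by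
  have h := norm_sq_force_le hν hf hfd hf0 hu hdiv hs hM
  nlinarith

end Summit.AnomalousDissipation.AnomalousDissipation.Cruxes.SteadyStatesLoudBounded.Disproof

end
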